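import Literature.Computability.MetaComplexity.DepthFregeWPHP
import HarnessLib

/-!
# Pudlák's greedy tree: the least-number principle, node formulas, Claims 2–3, top nodes

Part 4 of the discharge of `pudlak_ramseyFourPow_depthFrege_upperBound`: the cumulative finite
least-number principle (`LNPH.lnp`, linear in the interval length), the node formulas of
Pudlák's Reduction Lemma 1 (`Pat`, `Rn`, `Qn`, `nodeLists`, the bijective binary `code`), the
bundle `PK`, Claim 3 (`PK.disj_nodes`: two nodes with the same colours exclude each other), the
Ramsey clauses as virtual hypotheses (`PK.virtClause`) and the refutation of nodes of level
`s - 1` (`PK.refute_top`, the proof of Thm. 1 from the Reduction Lemma).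
-/

namespace Literature.Computability.MetaComplexity

open Complexity Complexity.PropForm

namespace DepthFrege

open TextbookFrege (disjList disjList_nil disjList_cons conjList conjList_nil conjList_cons)

/-! ### L12. The finite least-number principle (cumulative, linear ticks) -/

section LNP

variable {Q : SPrm}

/-- `Mf P a w = ⋀_{a < u < w} ¬ P u` ("no earlier witness above `a`"). [folklore] -/
def Mf (P : ℕ → PropForm ℕ) (a w : ℕ) : PropForm ℕ :=
  conjList (((List.range w).filter fun u => a < u).map fun u => neg (P u))

/-- `Tf P a w`: the list of `P v ∧ Mf v` for `a < v ≤ w` ("`v` is the least witness"). [folklore] -/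
def Tf (P : ℕ → PropForm ℕ) (a w : ℕ) : List (PropForm ℕ) :=
  ((List.range (w + 1)).filter fun v => a < v).map fun v => conj (P v) (Mf P a v)

/-- The least-number formula for `w`: `¬ P w ∨ ⋁ Tf w`. [folklore] -/
def LNPf (P : ℕ → PropForm ℕ) (a w : ℕ) : PropForm ℕ :=
  disj (neg (P w)) (disjList (Tf P a w))

/-- The cumulative conjunction `⋀_{a < u ≤ x} LNPf u`. [folklore] -/
def Af (P : ℕ → PropForm ℕ) (a x : ℕ) : PropForm ℕ :=
  conjList (((List.range (x + 1)).filter fun u => a < u).map fun u => LNPf P a u)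

/-- Size budgets of the least-number principle. [folklore] -/
def sMf (b sP : ℕ) : ℕ := b * (sP + 2) + 1
/-- Size budget. [folklore] -/
def sCf (b sP : ℕ) : ℕ := sP + sMf b sP + 1
/-- Size budget. [folklore] -/
def sTf (b sP : ℕ) : ℕ := (b + 1) * (sCf b sP + 1) + 1
/-- Size budget. [folklore] -/
def sLf (b sP : ℕ) : ℕ := sP + sTf b sP + 3
/-- Size budget. [folklore] -/
def sAf (b sP : ℕ) : ℕ := (b + 1) * (sLf b sP + 1) + 1
/-- Size budget of the least-number principle. [folklore] -/
def lnpM (b sP : ℕ) : ℕ := sAf b sP + 3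

/-- Auxiliary lemma `sCf_lt_sTf` (bounded-depth Frege toolkit / Pudlák–Krajíček construction, see the section header). [folklore] -/
theorem sCf_lt_sTf (b sP : ℕ) : sCf b sP + 1 ≤ sTf b sP := by
  unfold sTf; have := Nat.le_mul_of_pos_left (sCf b sP + 1) (show 0 < b + 1 from by omega); omega

/-- Auxiliary lemma `sLf_lt_sAf` (bounded-depth Frege toolkit / Pudlák–Krajíček construction, see the section header). [folklore] -/
theorem sLf_lt_sAf (b sP : ℕ) : sLf b sP + 1 ≤ sAf b sP := by
  unfold sAf; have := Nat.le_mul_of_pos_left (sLf b sP + 1) (show 0 < b + 1 from by omega); omega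

/-- Auxiliary lemma `lnpM_mono` (bounded-depth Frege toolkit / Pudlák–Krajíček construction, see the section header). [folklore] -/
theorem lnpM_mono {b b' : ℕ} (sP : ℕ) (h : b ≤ b') : lnpM b sP ≤ lnpM b' sP := by
  have h1 : sMf b sP ≤ sMf b' sP := by unfold sMf; have := Nat.mul_le_mul_right (sP + 2) h; omega
  have h2 : sCf b sP ≤ sCf b' sP := by unfold sCf; omega
  have h3 : sTf b sP ≤ sTf b' sP := by
    unfold sTf; have := Nat.mul_le_mul (show b + 1 ≤ b' + 1 from by omega) (show sCf b sP + 1 ≤ sCf b' sP + 1 from by omega); omega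
  have h4 : sLf b sP ≤ sLf b' sP := by unfold sLf; omega
  have h5 : sAf b sP ≤ sAf b' sP := by
    unfold sAf; have := Nat.mul_le_mul (show b + 1 ≤ b' + 1 from by omega) (show sLf b sP + 1 ≤ sLf b' sP + 1 from by omega); omega
  unfold lnpM; omega

/-- Auxiliary lemma `mem_MfList` (bounded-depth Frege toolkit / Pudlák–Krajíček construction, see the section header). [folklore] -/
theorem mem_MfList {P : ℕ → PropForm ℕ} {a w : ℕ} {A : PropForm ℕ} :
    A ∈ ((List.range w).filter fun u => a < u).map (fun u => neg (P u)) ↔ ∃ u, a < u ∧ u < w ∧ A = neg (P u) := by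
  simp only [List.mem_map, List.mem_filter, List.mem_range, decide_eq_true_eq]
  constructor
  · rintro ⟨u, ⟨h1, h2⟩, rfl⟩; exact ⟨u, h2, h1, rfl⟩
  · rintro ⟨u, h2, h1, rfl⟩; exact ⟨u, ⟨h1, h2⟩, rfl⟩

/-- Auxiliary lemma `mem_Tf` (bounded-depth Frege toolkit / Pudlák–Krajíček construction, see the section header). [folklore] -/
theorem mem_Tf {P : ℕ → PropForm ℕ} {a w : ℕ} {A : PropForm ℕ} :
    A ∈ Tf P a w ↔ ∃ v, a < v ∧ v ≤ w ∧ A = conj (P v) (Mf P a v) := by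
  simp only [Tf, List.mem_map, List.mem_filter, List.mem_range, decide_eq_true_eq]
  constructor
  · rintro ⟨u, ⟨h1, h2⟩, rfl⟩; exact ⟨u, h2, by omega, rfl⟩
  · rintro ⟨u, h2, h1, rfl⟩; exact ⟨u, ⟨by omega, h2⟩, rfl⟩

/-- Auxiliary lemma `mem_AfList` (bounded-depth Frege toolkit / Pudlák–Krajíček construction, see the section header). [folklore] -/
theorem mem_AfList {P : ℕ → PropForm ℕ} {a x : ℕ} {A : PropForm ℕ} :
    A ∈ ((List.range (x + 1)).filter fun u => a < u).map (fun u => LNPf P a u) ↔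
      ∃ u, a < u ∧ u ≤ x ∧ A = LNPf P a u := by
  simp only [List.mem_map, List.mem_filter, List.mem_range, decide_eq_true_eq]
  constructor
  · rintro ⟨u, ⟨h1, h2⟩, rfl⟩; exact ⟨u, h2, by omega, rfl⟩
  · rintro ⟨u, h2, h1, rfl⟩; exact ⟨u, ⟨by omega, h2⟩, rfl⟩

/-- Auxiliary lemma `length_filter_range_le` (bounded-depth Frege toolkit / Pudlák–Krajíček construction, see the section header). [folklore] -/
theorem length_filter_range_le (n a : ℕ) : ((List.range n).filter fun u => a < u).length ≤ n :=
  (List.length_filter_le _ _).trans (by simp)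

/-- Auxiliary lemma `length_Tf_le` (bounded-depth Frege toolkit / Pudlák–Krajíček construction, see the section header). [folklore] -/
theorem length_Tf_le (P : ℕ → PropForm ℕ) (a w : ℕ) : (Tf P a w).length ≤ w + 1 := by
  unfold Tf; rw [List.length_map]; exact length_filter_range_le _ _

/-- Auxiliary lemma `Tf_subset` (bounded-depth Frege toolkit / Pudlák–Krajíček construction, see the section header). [folklore] -/
theorem Tf_subset {P : ℕ → PropForm ℕ} {a w w' : ℕ} (h : w ≤ w') : ∀ A ∈ Tf P a w, A ∈ Tf P a w' := by
  intro A hA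
  obtain ⟨v, h1, h2, rfl⟩ := mem_Tf.1 hA
  exact mem_Tf.2 ⟨v, h1, by omega, rfl⟩

/-- Syntactic bounds of the least-number formulas. [folklore] -/
theorem lnp_bounds {P : ℕ → PropForm ℕ} {a b dP sP : ℕ}
    (hP : ∀ u, altDepth (P u) ≤ dP ∧ size (P u) ≤ sP) :
    (∀ w ≤ b, altDepth (Mf P a w) ≤ dP + 2 ∧ size (Mf P a w) ≤ sMf b sP) ∧
    (∀ w ≤ b, ∀ A ∈ Tf P a w, altDepth A ≤ dP + 3 ∧ size A ≤ sCf b sP) ∧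
    (∀ w ≤ b, altDepth (disjList (Tf P a w)) ≤ dP + 4 ∧ size (disjList (Tf P a w)) ≤ sTf b sP) ∧
    (∀ w ≤ b, altDepth (LNPf P a w) ≤ dP + 5 ∧ size (LNPf P a w) ≤ sLf b sP) ∧
    (∀ x ≤ b, altDepth (Af P a x) ≤ dP + 6 ∧ size (Af P a x) ≤ sAf b sP) := by
  have hM : ∀ w ≤ b, altDepth (Mf P a w) ≤ dP + 2 ∧ size (Mf P a w) ≤ sMf b sP := by
    intro w hw
    have hmem : ∀ A ∈ ((List.range w).filter fun u => a < u).map (fun u => neg (P u)),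
        altDepth A ≤ dP + 1 ∧ size A ≤ sP + 1 := by
      intro A hA
      obtain ⟨u, _, _, rfl⟩ := mem_MfList.1 hA
      exact ⟨(altDepth_neg_le _).trans (by have := (hP u).1; omega), by simp [size]; exact (hP u).2⟩
    refine ⟨altDepth_conjList_le fun A hA => (hmem A hA).1, ?_⟩
    refine (size_conjList_le fun A hA => (hmem A hA).2).trans ?_
    have hl : (((List.range w).filter fun u => a < u).map (fun u => neg (P u))).length ≤ b := by
      rw [List.length_map]; exact (length_filter_range_le w a).trans hw
    have := Nat.mul_le_mul_right (sP + 1 + 1) hl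
    unfold sMf
    rw [show sP + 1 + 1 = sP + 2 from rfl] at this ⊢
    omega
  have hT : ∀ w ≤ b, ∀ A ∈ Tf P a w, altDepth A ≤ dP + 3 ∧ size A ≤ sCf b sP := by
    intro w hw A hA
    obtain ⟨v, _, hv, rfl⟩ := mem_Tf.1 hA
    have hMv := hM v (by omega)
    refine ⟨(altDepth_conj_le _ _).trans ?_, by unfold sCf; simp [size]; have := (hP v).2; omega⟩
    have hPv := (hP v).1
    have : max (altDepth (P v)) (altDepth (Mf P a v)) ≤ dP + 2 := max_le (by omega) hMv.1
    omega
  have hD : ∀ w ≤ b, altDepth (disjList (Tf P a w)) ≤ dP + 4 ∧ size (disjList (Tf P a w)) ≤ sTf b sP := by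
    intro w hw
    refine ⟨altDepth_disjList_le fun A hA => (hT w hw A hA).1, ?_⟩
    refine (size_disjList_le fun A hA => (hT w hw A hA).2).trans ?_
    have hl : (Tf P a w).length ≤ b + 1 := (length_Tf_le P a w).trans (by omega)
    have := Nat.mul_le_mul_right (sCf b sP + 1) hl
    unfold sTf; omega
  have hL : ∀ w ≤ b, altDepth (LNPf P a w) ≤ dP + 5 ∧ size (LNPf P a w) ≤ sLf b sP := by
    intro w hw
    have hd := (hD w hw).1
    have hs := (hD w hw).2
    unfold LNPf
    refine ⟨(altDepth_disj_le _ _).trans ?_, ?_⟩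
    · have h1 := (altDepth_neg_le (P w)).trans (Nat.add_le_add_right (hP w).1 1)
      have : max (altDepth (neg (P w))) (altDepth (disjList (Tf P a w))) ≤ dP + 4 := max_le (by omega) hd
      omega
    · unfold sLf; simp only [size]; have := (hP w).2; omega
  refine ⟨hM, hT, hD, hL, ?_⟩
  intro x hx
  have hmem : ∀ A ∈ ((List.range (x + 1)).filter fun u => a < u).map (fun u => LNPf P a u),
      altDepth A ≤ dP + 5 ∧ size A ≤ sLf b sP := by
    intro A hA
    obtain ⟨u, _, hu, rfl⟩ := mem_AfList.1 hA
    exact hL u (by omega)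
  refine ⟨altDepth_conjList_le fun A hA => (hmem A hA).1, ?_⟩
  refine (size_conjList_le fun A hA => (hmem A hA).2).trans ?_
  have hl : (((List.range (x + 1)).filter fun u => a < u).map (fun u => LNPf P a u)).length ≤ b + 1 := by
    rw [List.length_map]; exact (length_filter_range_le _ _).trans (by omega)
  have := Nat.mul_le_mul_right (sLf b sP + 1) hl
  unfold sAf; omega

/-- Hypotheses bundle of the least-number principle. [folklore] -/
structure LNPH (Q : SPrm) where
  /-- the family of properties -/
  P : ℕ → PropForm ℕ
  /-- the lower end of the interval (exclusive) -/
  a : ℕ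
  /-- the upper end of the interval (inclusive) -/
  b : ℕ
  /-- depth bound of the family -/
  dP : ℕ
  /-- size bound of the family -/
  sP : ℕ
  /-- master bound -/
  Y : ℕ
  /-- `hP` -/
  hP : ∀ u, altDepth (P u) ≤ dP ∧ size (P u) ≤ sP
  /-- `hD` -/
  hD : dP + 7 ≤ Q.D
  /-- `hM` -/
  hM : lnpM b sP ≤ Q.M
  /-- `hY` -/
  hY : 4 ≤ Y
  /-- `hbY` -/
  hbY : b + 2 ≤ Y

namespace LNPH

variable (H : LNPH Q)

/-- Auxiliary lemma `base_all` (bounded-depth Frege toolkit / Pudlák–Krajíček construction, see the section header). [folklore] -/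
theorem base_all :
    (∀ u, Base Q (H.P u) ∧ Base Q (neg (H.P u)) ∧ Base Q (neg (neg (H.P u)))) ∧
    (∀ w ≤ H.b, Base Q (Mf H.P H.a w) ∧ Base Q (neg (Mf H.P H.a w))) ∧
    (∀ w ≤ H.b, ∀ A ∈ Tf H.P H.a w, Base Q A ∧ Base Q (neg A)) ∧
    (∀ w ≤ H.b, Base Q (disjList (Tf H.P H.a w)) ∧ Base Q (LNPf H.P H.a w) ∧
      Base Q (neg (LNPf H.P H.a w))) ∧
    (∀ x ≤ H.b, Base Q (Af H.P H.a x) ∧ Base Q (neg (Af H.P H.a x))) := by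
  obtain ⟨hM, hT, hDL, hL, hA⟩ := lnp_bounds (a := H.a) (b := H.b) H.hP
  have hD := H.hD
  have hMQ := H.hM
  have e1 : sMf H.b H.sP = H.b * (H.sP + 2) + 1 := rfl
  have e2 : sCf H.b H.sP = H.sP + sMf H.b H.sP + 1 := rfl
  have e3 := sCf_lt_sTf H.b H.sP
  have e4 : sLf H.b H.sP = H.sP + sTf H.b H.sP + 3 := rfl
  have e5 := sLf_lt_sAf H.b H.sP
  have e6 : lnpM H.b H.sP = sAf H.b H.sP + 3 := rfl
  refine ⟨fun u => ?_, ?_, ?_, ?_, ?_⟩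
  · have h1 := (H.hP u).1; have h2 := (H.hP u).2
    have h3 := altDepth_neg_le (H.P u); have h4 := altDepth_neg_le (neg (H.P u))
    exact ⟨⟨by omega, by omega⟩, ⟨by omega, by simp [size]; omega⟩, ⟨by omega, by simp [size]; omega⟩⟩
  · intro w hw
    have h1 := hM w hw; have h3 := altDepth_neg_le (Mf H.P H.a w)
    exact ⟨⟨by omega, by omega⟩, ⟨by omega, by simp [size]; omega⟩⟩
  · intro w hw A hA
    have h1 := hT w hw A hA; have h3 := altDepth_neg_le A
    exact ⟨⟨by omega, by omega⟩, ⟨by omega, by simp [size]; omega⟩⟩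
  · intro w hw
    have h1 := hL w hw; have h2 := hDL w hw; have h3 := altDepth_neg_le (LNPf H.P H.a w)
    exact ⟨⟨by omega, by omega⟩, ⟨by omega, by omega⟩, ⟨by omega, by simp [size]; omega⟩⟩
  · intro x hx
    have h1 := hA x hx; have h3 := altDepth_neg_le (Af H.P H.a x)
    exact ⟨⟨by omega, by omega⟩, ⟨by omega, by simp [size]; omega⟩⟩

/-- Auxiliary lemma `ypow_mono` (bounded-depth Frege toolkit / Pudlák–Krajíček construction, see the section header). [folklore] -/
theorem ypow_mono {i j : ℕ} (hij : i ≤ j) : H.Y ^ i ≤ H.Y ^ j :=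
  Nat.pow_le_pow_right (by have := H.hY; omega) hij

/-- Auxiliary lemma `ydbl` (bounded-depth Frege toolkit / Pudlák–Krajíček construction, see the section header). [folklore] -/
theorem ydbl (i : ℕ) : H.Y ^ i + H.Y ^ i ≤ H.Y ^ (i + 1) := by
  have hY := H.hY
  rw [pow_succ]
  calc H.Y ^ i + H.Y ^ i = H.Y ^ i * 2 := by ring
    _ ≤ H.Y ^ i * H.Y := Nat.mul_le_mul_left _ (by omega)

/-- Auxiliary lemma `yquad` (bounded-depth Frege toolkit / Pudlák–Krajíček construction, see the section header). [folklore] -/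
theorem yquad (i : ℕ) : 4 * H.Y ^ i ≤ H.Y ^ (i + 1) := by
  have hY := H.hY
  rw [pow_succ]
  calc 4 * H.Y ^ i = H.Y ^ i * 4 := by ring
    _ ≤ H.Y ^ i * H.Y := Nat.mul_le_mul_left _ hY

/-- Auxiliary lemma `yge` (bounded-depth Frege toolkit / Pudlák–Krajíček construction, see the section header). [folklore] -/
theorem yge (i : ℕ) (hi : 1 ≤ i) : H.Y ≤ H.Y ^ i := by
  calc H.Y = H.Y ^ 1 := (pow_one _).symm
    _ ≤ H.Y ^ i := H.ypow_mono hi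

/-- Auxiliary lemma `b_le_Y` (bounded-depth Frege toolkit / Pudlák–Krajíček construction, see the section header). [folklore] -/
theorem b_le_Y : H.b + 2 ≤ H.Y ^ 1 := by simpa using H.hbY

/-- Unpacking a least-number formula that is available as a hypothesis: if `¬ LNPf u` may be added
to a sequent containing `Tf u`-targets, then `¬ P u` may. Precisely: from the membership of
`LNPf u` in the cumulative conjunction `Af x` (with `¬ Af x ∈ L'`), derive `¬ P u`. [folklore] -/
theorem unpack {u x : ℕ} (hu : H.a < u) (hux : u ≤ x) (hx : x ≤ H.b) {L' : List (PropForm ℕ)}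
    (hL' : ∀ A ∈ L', Base Q A) (hAf : neg (Af H.P H.a x) ∈ L') (hT : ∀ A ∈ Tf H.P H.a u, A ∈ L')
    (hW : L'.length + u + 6 ≤ Q.W) : Sq Q (H.Y ^ 3) (neg (H.P u) :: L') := by
  obtain ⟨bP, bM, bT, bL, bA⟩ := H.base_all
  have hub : u ≤ H.b := by omega
  have hY := H.hY
  set Lu := LNPf H.P H.a u with hLu
  have s0 : Sq Q 1 (Lu :: neg Lu :: L') :=
    Sq.ax (A := Lu) (by
      intro C hC; simp only [List.mem_cons] at hC
      rcases hC with rfl | rfl | hC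
      · exact (bL u hub).2.1
      · exact (bL u hub).2.2
      · exact hL' C hC) (by simp; omega) (by simp) (by simp)
  have s1 : Sq Q (1 + 1) (neg (H.P u) :: disjList (Tf H.P H.a u) :: neg Lu :: L') :=
    Sq.unDisj s0 (by simp; omega)
  have s2 := s1.swap
  have s3 : Sq Q (1 + 1 + 1 + 3 * (Tf H.P H.a u).length + 3) (Tf H.P H.a u ++ neg (H.P u) :: neg Lu :: L') :=
    Sq.unDisjList _ s2 (by simp; have := length_Tf_le H.P H.a u; omega)
  have s4 : Sq Q (1 + 1 + 1 + 3 * (Tf H.P H.a u).length + 3 + 1) (neg Lu :: neg (H.P u) :: L') :=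
    s3.weaken₂ _ (by
        intro C hC; simp only [List.mem_append, List.mem_cons] at hC ⊢
        rcases hC with hC | rfl | rfl | hC
        · exact Or.inr (Or.inr (hT C hC))
        · exact Or.inr (Or.inl rfl)
        · exact Or.inl rfl
        · exact Or.inr (Or.inr hC))
      (by intro C hC; simp only [List.mem_append, List.mem_cons] at hC ⊢; tauto) (by simp; omega)
  have hmem : Lu ∈ ((List.range (x + 1)).filter fun u => H.a < u).map (fun u => LNPf H.P H.a u) :=
    mem_AfList.2 ⟨u, hu, hux, rfl⟩
  have s5 := Sq.negAndOfMem (L := neg (H.P u) :: L') (by simp; omega) _ hmem (bA x hx).2 s4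
  have s6 := s5.weaken₂ (neg (H.P u) :: L')
    (by
      intro C hC; simp only [List.mem_cons] at hC ⊢
      rcases hC with rfl | rfl | hC
      · exact Or.inr hAf
      · exact Or.inl rfl
      · exact Or.inr hC)
    (by intro C hC; simp only [List.mem_cons] at hC ⊢; tauto) (by simp; omega)
  refine s6.mono ?_
  have h1 := length_Tf_le H.P H.a u
  have h2 : (((List.range (x + 1)).filter fun u => H.a < u).map (fun u => LNPf H.P H.a u)).length ≤ H.b + 1 := by
    rw [List.length_map]; exact (length_filter_range_le _ _).trans (by omega)
  have h3 := H.b_le_Y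
  have h4 : H.Y ^ 1 * H.Y ^ 1 = H.Y ^ 2 := by ring
  have h5 : H.Y ^ 2 + H.Y ^ 2 ≤ H.Y ^ 3 := H.ydbl 2
  nlinarith

/-- Auxiliary lemma `Y3_le` (bounded-depth Frege toolkit / Pudlák–Krajíček construction, see the section header). [folklore] -/
theorem Y3_le : H.b * (H.Y ^ 3 + 1) + 4 ≤ H.Y ^ 5 := by
  have hY := H.hY
  have h1 : H.b ≤ H.Y := by have := H.hbY; omega
  have h2 : H.b * (H.Y ^ 3 + 1) ≤ H.Y * (H.Y ^ 3 + 1) := Nat.mul_le_mul_right _ h1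
  have h3 : H.Y * (H.Y ^ 3 + 1) = H.Y ^ 4 + H.Y := by ring
  have h4 : H.Y ≤ H.Y ^ 4 := H.yge 4 (by norm_num)
  have h5 : 4 * H.Y ^ 4 ≤ H.Y ^ 5 := H.yquad 4
  omega

variable {L : List (PropForm ℕ)} (hL : ∀ A ∈ L, Base Q A) (hW : L.length + 2 * H.b + 12 ≤ Q.W)
include hL hW

/-- The core of the inductive step: `x + 1` is the least witness, or an earlier one is. [folklore] -/
theorem core {x : ℕ} (hx : H.a ≤ x) (hx1 : x + 1 ≤ H.b) :
    Sq Q (H.Y ^ 5) (neg (H.P (x + 1)) :: (Tf H.P H.a (x + 1) ++ (neg (Af H.P H.a x) :: L))) := by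
  obtain ⟨bP, bM, bT, bL, bA⟩ := H.base_all
  have hY := H.hY
  set REST := neg (H.P (x + 1)) :: (Tf H.P H.a (x + 1) ++ (neg (Af H.P H.a x) :: L)) with hREST
  have hTl := length_Tf_le H.P H.a (x + 1)
  have hRESTB : ∀ C ∈ REST, Base Q C := by
    intro C hC
    simp only [hREST, List.mem_cons, List.mem_append] at hC
    rcases hC with rfl | hC | rfl | hC
    · exact (bP _).2.1
    · exact (bT (x + 1) hx1 C hC).1
    · exact (bA x (by omega)).2
    · exact hL C hC
  have hRESTl : REST.length = (Tf H.P H.a (x + 1)).length + L.length + 2 := by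
    simp [hREST]; omega
  have p1 : Sq Q 1 (H.P (x + 1) :: REST) :=
    Sq.ax (A := H.P (x + 1)) (by
      intro C hC; simp only [List.mem_cons] at hC
      rcases hC with rfl | hC
      · exact (bP _).1
      · exact hRESTB C hC) (by rw [List.length_cons, hRESTl]; omega) (by simp) (by simp [hREST])
  have p2 := Sq.andIntro (L := REST) hRESTB (by rw [hRESTl]; omega)
    (((List.range (x + 1)).filter fun u => H.a < u).map fun u => neg (H.P u)) (bM (x + 1) hx1).1
    (t := H.Y ^ 3) (by
      intro A hA
      obtain ⟨u, hu1, hu2, rfl⟩ := mem_MfList.1 hA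
      exact H.unpack hu1 (show u ≤ x from by omega) (by omega) hRESTB (by simp [hREST])
        (fun C hC => by
          simp only [hREST, List.mem_cons, List.mem_append]
          exact Or.inr (Or.inl (Tf_subset (by omega) C hC)))
        (by rw [hRESTl]; omega))
  have hCmem : conj (H.P (x + 1)) (Mf H.P H.a (x + 1)) ∈ Tf H.P H.a (x + 1) :=
    mem_Tf.2 ⟨x + 1, by omega, le_rfl, rfl⟩
  have p3 := Sq.consConj p1 p2 (bT (x + 1) hx1 _ hCmem).1
  have p4 := p3.weaken₂ REST
    (by
      intro C hC; simp only [List.mem_cons] at hC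
      rcases hC with rfl | hC
      · simp only [hREST, List.mem_cons, List.mem_append]; exact Or.inr (Or.inl hCmem)
      · exact hC)
    (fun C hC => Or.inr (hRESTB C hC)) (by rw [hRESTl]; omega)
  refine p4.mono ?_
  have hl : (((List.range (x + 1)).filter fun u => H.a < u).map fun u => neg (H.P u)).length ≤ H.b := by
    rw [List.length_map]; exact (length_filter_range_le _ _).trans (by omega)
  have := Nat.mul_le_mul_right (H.Y ^ 3 + 1) hl
  have := H.Y3_le
  omega

/-- The new component of the cumulative step. [folklore] -/
theorem newComp {x : ℕ} (hx : H.a ≤ x) (hx1 : x + 1 ≤ H.b) :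
    Sq Q (H.Y ^ 6) (LNPf H.P H.a (x + 1) :: neg (Af H.P H.a x) :: L) := by
  obtain ⟨bP, bM, bT, bL, bA⟩ := H.base_all
  have hY := H.hY
  have hTl := length_Tf_le H.P H.a (x + 1)
  have c0 := H.core hL hW hx hx1
  have c1 : Sq Q (H.Y ^ 5 + 1) (Tf H.P H.a (x + 1) ++ (neg (H.P (x + 1)) :: neg (Af H.P H.a x) :: L)) :=
    c0.weaken₂ _ (by intro C hC; simp only [List.mem_cons, List.mem_append] at hC ⊢; tauto)
      (by intro C hC; simp only [List.mem_cons, List.mem_append] at hC ⊢; tauto)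
      (by simp; omega)
  have c2 := Sq.orIntro _ c1 (bL (x + 1) hx1).1 (by simp; omega)
  have c3 := c2.swap
  have c4 := Sq.consDisj c3 (bL (x + 1) hx1).2.1
  refine c4.mono ?_
  have h1 : 3 * (Tf H.P H.a (x + 1)).length + 5 ≤ H.Y ^ 5 := by
    have : 3 * (Tf H.P H.a (x + 1)).length + 5 ≤ 4 * H.Y := by have := H.hbY; omega
    have h4 : 4 * H.Y ^ 1 ≤ H.Y ^ 2 := H.yquad 1
    have : H.Y ^ 2 ≤ H.Y ^ 5 := H.ypow_mono (by norm_num)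
    simp at h4; omega
  have : H.Y ^ 5 + H.Y ^ 5 ≤ H.Y ^ 6 := H.ydbl 5
  omega

/-- An old component of the cumulative step. [folklore] -/
theorem oldComp {u x : ℕ} (hu : H.a < u) (hux : u ≤ x) (hx : x ≤ H.b) :
    Sq Q (H.Y ^ 2) (LNPf H.P H.a u :: neg (Af H.P H.a x) :: L) := by
  obtain ⟨bP, bM, bT, bL, bA⟩ := H.base_all
  have hY := H.hY
  have hub : u ≤ H.b := by omega
  have s0 : Sq Q 1 (neg (LNPf H.P H.a u) :: LNPf H.P H.a u :: L) :=
    Sq.ax (A := LNPf H.P H.a u) (by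
      intro C hC; simp only [List.mem_cons] at hC
      rcases hC with rfl | rfl | hC
      · exact (bL u hub).2.2
      · exact (bL u hub).2.1
      · exact hL C hC) (by simp; omega) (by simp) (by simp)
  have hmem : LNPf H.P H.a u ∈ ((List.range (x + 1)).filter fun u => H.a < u).map (fun u => LNPf H.P H.a u) :=
    mem_AfList.2 ⟨u, hu, hux, rfl⟩
  have s1 := Sq.negAndOfMem (L := LNPf H.P H.a u :: L) (by simp; omega) _ hmem (bA x hx).2 s0
  have s2 := s1.swap
  refine s2.mono ?_
  have h2 : (((List.range (x + 1)).filter fun u => H.a < u).map (fun u => LNPf H.P H.a u)).length ≤ H.b + 1 := by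
    rw [List.length_map]; exact (length_filter_range_le _ _).trans (by omega)
  have h4 : 4 * H.Y ^ 1 ≤ H.Y ^ 2 := H.yquad 1
  have := H.hbY
  simp at h4
  omega

/-- The cumulative step `Af x ⊢ Af (x+1)`. [folklore] -/
theorem stepA {x : ℕ} (hx : H.a ≤ x) (hx1 : x + 1 ≤ H.b) :
    Sq Q (H.Y ^ 8) (Af H.P H.a (x + 1) :: neg (Af H.P H.a x) :: L) := by
  obtain ⟨bP, bM, bT, bL, bA⟩ := H.base_all
  have hY := H.hY
  have hLb : ∀ C ∈ neg (Af H.P H.a x) :: L, Base Q C := by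
    intro C hC; simp only [List.mem_cons] at hC
    rcases hC with rfl | hC
    · exact (bA x (by omega)).2
    · exact hL C hC
  have h := Sq.andIntro (L := neg (Af H.P H.a x) :: L) hLb (by simp; omega)
    (((List.range (x + 1 + 1)).filter fun u => H.a < u).map fun u => LNPf H.P H.a u) (bA (x + 1) hx1).1
    (t := H.Y ^ 6) (by
      intro A hA
      obtain ⟨u, hu1, hu2, rfl⟩ := mem_AfList.1 hA
      rcases Nat.eq_or_lt_of_le hu2 with rfl | hlt
      · exact H.newComp hL hW hx hx1
      · exact (H.oldComp hL hW hu1 (show u ≤ x from by omega) (by omega)).mono (H.ypow_mono (by norm_num)))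
  refine h.mono ?_
  have hl : (((List.range (x + 1 + 1)).filter fun u => H.a < u).map fun u => LNPf H.P H.a u).length ≤ H.b + 1 := by
    rw [List.length_map]; exact (length_filter_range_le _ _).trans (by omega)
  have h1 := Nat.mul_le_mul_right (H.Y ^ 6 + 1) hl
  have h2 : (H.b + 1) * (H.Y ^ 6 + 1) + 1 ≤ H.Y ^ 8 := by
    have : H.b + 1 ≤ H.Y := by have := H.hbY; omega
    have h3 : (H.b + 1) * (H.Y ^ 6 + 1) ≤ H.Y * (H.Y ^ 6 + 1) := Nat.mul_le_mul_right _ this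
    have h4 : H.Y * (H.Y ^ 6 + 1) = H.Y ^ 7 + H.Y := by ring
    have h5 : H.Y + 1 ≤ H.Y ^ 7 := by
      have h6 : H.Y ^ 1 + H.Y ^ 1 ≤ H.Y ^ 2 := H.ydbl 1
      have : H.Y ^ 2 ≤ H.Y ^ 7 := H.ypow_mono (by norm_num); simp at h6; omega
    have : H.Y ^ 7 + H.Y ^ 7 ≤ H.Y ^ 8 := H.ydbl 7
    omega
  omega

/-- The cumulative conjunctions are derivable. [folklore] -/
theorem chain : ∀ n : ℕ, H.a + n ≤ H.b → Sq Q ((n + 1) * H.Y ^ 9) (Af H.P H.a (H.a + n) :: L)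
  | 0, _ => by
    obtain ⟨bP, bM, bT, bL, bA⟩ := H.base_all
    have hY := H.hY
    have h := Sq.andIntro (L := L) hL (by omega)
      (((List.range (H.a + 0 + 1)).filter fun u => H.a < u).map fun u => LNPf H.P H.a u)
      (bA (H.a + 0) (by omega)).1 (t := 0) (by
        intro A hA
        obtain ⟨u, hu1, hu2, rfl⟩ := mem_AfList.1 hA
        omega)
    refine h.mono ?_
    have : (((List.range (H.a + 0 + 1)).filter fun u => H.a < u).map fun u => LNPf H.P H.a u).length = 0 := by
      rw [List.length_eq_zero_iff, List.map_eq_nil_iff, List.filter_eq_nil_iff]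
      intro u hu; simp at hu ⊢; omega
    rw [this]
    have : 1 ≤ H.Y ^ 9 := Nat.one_le_pow _ _ (by omega)
    omega
  | n + 1, hn => by
    obtain ⟨bP, bM, bT, bL, bA⟩ := H.base_all
    have hY := H.hY
    have ih := chain n (by omega)
    have st := H.stepA hL hW (x := H.a + n) (by omega) (by omega)
    rw [show H.a + n + 1 = H.a + (n + 1) from by omega] at st
    have w1 := ih.weaken₂ (Af H.P H.a (H.a + n) :: Af H.P H.a (H.a + (n + 1)) :: L)
      (by intro C hC; simp only [List.mem_cons] at hC ⊢; tauto)
      (by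
        intro C hC; simp only [List.mem_cons] at hC ⊢
        rcases hC with rfl | rfl | hC
        · exact Or.inl (Or.inl rfl)
        · exact Or.inr (bA _ hn).1
        · exact Or.inl (Or.inr hC))
      (by simp; omega)
    have w2 := st.swap
    have c := Sq.cut w1 w2
    refine c.mono ?_
    have : H.Y ^ 8 + 3 ≤ H.Y ^ 9 := by
      have := H.yge 8 (by norm_num)
      have : H.Y ^ 8 + H.Y ^ 8 ≤ H.Y ^ 9 := H.ydbl 8; omega
    have e : (n + 1 + 1) * H.Y ^ 9 = (n + 1) * H.Y ^ 9 + H.Y ^ 9 := by ring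
    omega

/-- **The finite least-number principle**: if `P b` then some `a < v ≤ b` is the least witness
above `a`. [folklore] -/
theorem lnp (hab : H.a < H.b) : Sq Q (H.Y ^ 11) (neg (H.P H.b) :: (Tf H.P H.a H.b ++ L)) := by
  obtain ⟨bP, bM, bT, bL, bA⟩ := H.base_all
  have hY := H.hY
  have hTl := length_Tf_le H.P H.a H.b
  have d0 := H.chain hL hW (H.b - H.a) (by omega)
  rw [show H.a + (H.b - H.a) = H.b from by omega] at d0
  have hTB : ∀ C ∈ Tf H.P H.a H.b, Base Q C := fun C hC => (bT H.b le_rfl C hC).1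
  have u0 := H.unpack (u := H.b) (x := H.b) hab le_rfl le_rfl (L' := Tf H.P H.a H.b ++ (neg (Af H.P H.a H.b) :: L))
    (by
      intro C hC; simp only [List.mem_append, List.mem_cons] at hC
      rcases hC with hC | rfl | hC
      · exact hTB C hC
      · exact (bA H.b le_rfl).2
      · exact hL C hC)
    (by simp) (fun C hC => by simp [hC]) (by simp; omega)
  have u1 := u0.weaken₂ (neg (Af H.P H.a H.b) :: (neg (H.P H.b) :: (Tf H.P H.a H.b ++ L)))
    (by intro C hC; simp only [List.mem_cons, List.mem_append] at hC ⊢; tauto)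
    (by intro C hC; simp only [List.mem_cons, List.mem_append] at hC ⊢; tauto) (by simp; omega)
  have d1 := d0.weaken₂ (Af H.P H.a H.b :: (neg (H.P H.b) :: (Tf H.P H.a H.b ++ L)))
    (by intro C hC; simp only [List.mem_cons, List.mem_append] at hC ⊢; tauto)
    (by
      intro C hC; simp only [List.mem_cons, List.mem_append] at hC ⊢
      rcases hC with rfl | rfl | hC | hC
      · exact Or.inl (Or.inl rfl)
      · exact Or.inr (bP _).2.1
      · exact Or.inr (hTB C hC)
      · exact Or.inl (Or.inr hC))
    (by simp; omega)
  have c := Sq.cut d1 u1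
  refine c.mono ?_
  have h1 : (H.b - H.a + 1) * H.Y ^ 9 ≤ H.Y ^ 10 := by
    have : H.b - H.a + 1 ≤ H.Y := by have := H.hbY; omega
    calc _ ≤ H.Y * H.Y ^ 9 := Nat.mul_le_mul_right _ this
      _ = H.Y ^ 10 := by ring
  have h2 : H.Y ^ 3 + 3 ≤ H.Y ^ 10 := by
    have := H.yge 3 (by norm_num)
    have : H.Y ^ 3 + H.Y ^ 3 ≤ H.Y ^ 4 := H.ydbl 3
    have : H.Y ^ 4 ≤ H.Y ^ 10 := H.ypow_mono (by norm_num); omega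
  have : H.Y ^ 10 + H.Y ^ 10 ≤ H.Y ^ 11 := H.ydbl 10
  omega

end LNPH

end LNP


/-! ### L13. Pudlák's greedy tree: formulas, codes, enumerations -/

section PudlakDefs

/-- Edge variable of `{a, b}`, `a < b < N` (as in `ramseyCNF`). [cite: Pudlak1991, §2 (Reduction Lemma 1)] -/
def ev (N a b : ℕ) : ℕ := a * N + b

/-- The literal "edge `{a, b}` has colour `β`" (`true` = present). [cite: Pudlak1991, §2 (Reduction Lemma 1)] -/
def lit (N a b : ℕ) (β : Bool) : PropForm ℕ :=
  if β then var (ev N a b) else neg (var (ev N a b))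

/-- Pattern of `x` with respect to the coloured vertices `ps` (most recent first). [cite: Pudlak1991, §2 (Reduction Lemma 1)] -/
def Pat (N : ℕ) : List (ℕ × Bool) → ℕ → PropForm ℕ
  | (a, β) :: ps, x => conj (Pat N ps x) (lit N a x β)
  | [], _ => const true

/-- Node formula `R` of Pudlák's Reduction Lemma 1 for the node with top vertex `x` above the
coloured vertices `ps = [(x_{j-1}, α_{j-1}), …, (x_0, α_0)]`: every vertex has the colour
pattern towards the earlier vertices and is minimal with it. [cite: Pudlak1991, §2 (Reduction Lemma 1)] -/
def Rn (N : ℕ) : ℕ → List (ℕ × Bool) → PropForm ℕ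
  | x, (y, β) :: ps => conj (conj (Rn N y ps) (Pat N ((y, β) :: ps) x)) (Mf (Pat N ((y, β) :: ps)) y x)
  | _, [] => const true

/-- "`x` is alive below the node `(y, ps)` extended by the colour `β` of `y`". [cite: Pudlak1991, §2 (Reduction Lemma 1)] -/
def Qn (N y : ℕ) (ps : List (ℕ × Bool)) (β : Bool) (x : ℕ) : PropForm ℕ :=
  conj (Rn N y ps) (Pat N ((y, β) :: ps) x)

/-- Auxiliary lemma `Rn_cons` (bounded-depth Frege toolkit / Pudlák–Krajíček construction, see the section header). [cite: Pudlak1991, §2 (Reduction Lemma 1)] -/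
theorem Rn_cons (N x y : ℕ) (β : Bool) (ps : List (ℕ × Bool)) :
    Rn N x ((y, β) :: ps) = conj (Qn N y ps β x) (Mf (Pat N ((y, β) :: ps)) y x) := rfl

/-- Bijective binary code of a colour list. [cite: Pudlak1991, §2 (Reduction Lemma 1)] -/
def code : List Bool → ℕ
  | [] => 0
  | b :: bs => (if b then 2 else 1) + 2 * code bs

/-- Auxiliary lemma `code_lt` (bounded-depth Frege toolkit / Pudlák–Krajíček construction, see the section header). [cite: Pudlak1991, §2 (Reduction Lemma 1)] -/
theorem code_lt : ∀ bs : List Bool, code bs + 2 ≤ 2 ^ (bs.length + 1)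
  | [] => by simp [code]
  | b :: bs => by
    have := code_lt bs
    simp only [code, List.length_cons, pow_succ] at this ⊢
    split_ifs <;> omega

/-- Auxiliary lemma `code_injective` (bounded-depth Frege toolkit / Pudlák–Krajíček construction, see the section header). [cite: Pudlak1991, §2 (Reduction Lemma 1)] -/
theorem code_injective : ∀ bs bs' : List Bool, code bs = code bs' → bs = bs'
  | [], [], _ => rfl
  | [], b :: bs, h => by simp only [code] at h; split_ifs at h <;> omega
  | b :: bs, [], h => by simp only [code] at h; split_ifs at h <;> omega
  | b :: bs, b' :: bs', h => by
    simp only [code] at h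
    have hb : b = b' := by
      cases b <;> cases b' <;> simp at h ⊢ <;> omega
    subst hb
    have : code bs = code bs' := by split_ifs at h <;> omega
    rw [code_injective bs bs' this]

/-- All nodes of level `j` with top vertex `x`: the coloured lower parts. [cite: Pudlak1991, §2 (Reduction Lemma 1)] -/
def nodeLists : ℕ → ℕ → List (List (ℕ × Bool))
  | 0, x => if x = 0 then [[]] else []
  | j + 1, x => (List.range x).flatMap fun y => (nodeLists j y).flatMap fun ps =>
      [(y, false) :: ps, (y, true) :: ps]

/-- Auxiliary lemma `mem_nodeLists_zero` (bounded-depth Frege toolkit / Pudlák–Krajíček construction, see the section header). [cite: Pudlak1991, §2 (Reduction Lemma 1)] -/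
theorem mem_nodeLists_zero {x : ℕ} {ps : List (ℕ × Bool)} : ps ∈ nodeLists 0 x ↔ x = 0 ∧ ps = [] := by
  simp only [nodeLists]; split_ifs with h <;> simp [h]

/-- Auxiliary lemma `mem_nodeLists_succ` (bounded-depth Frege toolkit / Pudlák–Krajíček construction, see the section header). [cite: Pudlak1991, §2 (Reduction Lemma 1)] -/
theorem mem_nodeLists_succ {j x : ℕ} {ps : List (ℕ × Bool)} :
    ps ∈ nodeLists (j + 1) x ↔ ∃ y < x, ∃ ps' ∈ nodeLists j y, ∃ β, ps = (y, β) :: ps' := by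
  simp only [nodeLists, List.mem_flatMap, List.mem_range, List.mem_cons, List.mem_nil_iff, or_false]
  constructor
  · rintro ⟨y, hy, ps', hps', rfl | rfl⟩
    · exact ⟨y, hy, ps', hps', false, rfl⟩
    · exact ⟨y, hy, ps', hps', true, rfl⟩
  · rintro ⟨y, hy, ps', hps', β, rfl⟩
    refine ⟨y, hy, ps', hps', ?_⟩
    cases β
    · exact Or.inl rfl
    · exact Or.inr rfl

/-- Auxiliary lemma `nodeLists_spec` (bounded-depth Frege toolkit / Pudlák–Krajíček construction, see the section header). [cite: Pudlak1991, §2 (Reduction Lemma 1)] -/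
theorem nodeLists_spec : ∀ {j x : ℕ} {ps : List (ℕ × Bool)}, ps ∈ nodeLists j x →
    ps.length = j ∧ ∀ p ∈ ps, p.1 < x
  | 0, x, ps, h => by
    obtain ⟨rfl, rfl⟩ := mem_nodeLists_zero.1 h
    simp
  | j + 1, x, ps, h => by
    obtain ⟨y, hy, ps', hps', β, rfl⟩ := mem_nodeLists_succ.1 h
    obtain ⟨hl, hv⟩ := nodeLists_spec hps'
    refine ⟨by simp [hl], ?_⟩
    intro p hp
    simp only [List.mem_cons] at hp
    rcases hp with rfl | hp
    · exact hy
    · exact (hv p hp).trans hy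

/-- Auxiliary lemma `nodeLists_pairwise` (bounded-depth Frege toolkit / Pudlák–Krajíček construction, see the section header). [cite: Pudlak1991, §2 (Reduction Lemma 1)] -/
theorem nodeLists_pairwise : ∀ {j x : ℕ} {ps : List (ℕ × Bool)}, ps ∈ nodeLists j x →
    (x :: ps.map Prod.fst).Pairwise (· > ·)
  | 0, x, ps, h => by
    obtain ⟨rfl, rfl⟩ := mem_nodeLists_zero.1 h
    simp
  | j + 1, x, ps, h => by
    obtain ⟨y, hy, ps', hps', β, rfl⟩ := mem_nodeLists_succ.1 h
    have ih := nodeLists_pairwise hps'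
    have hv := (nodeLists_spec hps').2
    rw [List.map_cons, List.pairwise_cons]
    refine ⟨?_, ih⟩
    intro v hv'
    simp only [List.mem_cons, List.mem_map] at hv'
    rcases hv' with rfl | ⟨p, hp, rfl⟩
    · exact hy
    · exact (hv p hp).trans hy

/-- Auxiliary lemma `length_nodeLists_le` (bounded-depth Frege toolkit / Pudlák–Krajíček construction, see the section header). [cite: Pudlak1991, §2 (Reduction Lemma 1)] -/
theorem length_nodeLists_le : ∀ (j x N : ℕ), x < N → (nodeLists j x).length ≤ (2 * N) ^ j
  | 0, x, N, _ => by simp only [nodeLists]; split_ifs <;> simp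
  | j + 1, x, N, hx => by
    simp only [nodeLists]
    refine (length_flatMap_le _ _ (2 * (2 * N) ^ j) fun y hy => ?_).trans ?_
    · refine (length_flatMap_le _ _ 2 fun ps _ => by simp).trans ?_
      rw [Nat.mul_comm]
      exact Nat.mul_le_mul_left _ (length_nodeLists_le j y N ((List.mem_range.1 hy).trans hx))
    · rw [List.length_range, pow_succ]
      calc x * (2 * (2 * N) ^ j) = (2 * x) * (2 * N) ^ j := by ring
        _ ≤ (2 * N) * (2 * N) ^ j := Nat.mul_le_mul_right _ (by omega)
        _ = (2 * N) ^ j * (2 * N) := by ring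

/-- Pudlák's map as a flat relation: vertex `x` goes to the hole `code` (colours) of any node of
level `j ≤ s - 2` that it heads. [cite: Pudlak1991, §2 (Reduction Lemma 1)] -/
def Kp (N s : ℕ) : Rel := fun x yh =>
  if x < N then
    (List.range (s - 1)).flatMap fun j =>
      ((nodeLists j x).filter fun ps => code (ps.map Prod.snd) = yh).map fun ps => Rn N x ps
  else []

/-- Auxiliary lemma `mem_Kp` (bounded-depth Frege toolkit / Pudlák–Krajíček construction, see the section header). [cite: Pudlak1991, §2 (Reduction Lemma 1)] -/
theorem mem_Kp {N s x yh : ℕ} {κ : PropForm ℕ} :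
    κ ∈ Kp N s x yh ↔ x < N ∧ ∃ j, j + 1 < s ∧ ∃ ps ∈ nodeLists j x, code (ps.map Prod.snd) = yh ∧ κ = Rn N x ps := by
  unfold Kp
  split_ifs with hx
  · simp only [List.mem_flatMap, List.mem_range, List.mem_map, List.mem_filter, decide_eq_true_eq, hx, true_and]
    constructor
    · rintro ⟨j, hj, ps, ⟨hps, hc⟩, rfl⟩; exact ⟨j, by omega, ps, hps, hc, rfl⟩
    · rintro ⟨j, hj, ps, hps, hc, rfl⟩; exact ⟨j, by omega, ps, ⟨hps, hc⟩, rfl⟩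
  · simp [hx]

/-! #### Syntactic bounds -/

/-- Auxiliary lemma `size_lit` (bounded-depth Frege toolkit / Pudlák–Krajíček construction, see the section header). [cite: Pudlak1991, §2 (Reduction Lemma 1)] -/
theorem size_lit (N a b : ℕ) (β : Bool) : size (lit N a b β) ≤ 2 := by
  unfold lit; split_ifs <;> simp [size]

/-- Auxiliary lemma `altDepth_lit` (bounded-depth Frege toolkit / Pudlák–Krajíček construction, see the section header). [cite: Pudlak1991, §2 (Reduction Lemma 1)] -/
theorem altDepth_lit (N a b : ℕ) (β : Bool) : altDepth (lit N a b β) ≤ 1 ∧ altDepthAux 2 (lit N a b β) ≤ 1 := by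
  unfold lit; split_ifs <;> simp [altDepth, altDepthAux]

/-- Auxiliary lemma `Pat_bounds` (bounded-depth Frege toolkit / Pudlák–Krajíček construction, see the section header). [cite: Pudlak1991, §2 (Reduction Lemma 1)] -/
theorem Pat_bounds (N : ℕ) : ∀ (ps : List (ℕ × Bool)) (x : ℕ),
    altDepthAux 2 (Pat N ps x) ≤ 1 ∧ size (Pat N ps x) ≤ 3 * ps.length + 1
  | [], x => by simp [Pat, size]
  | (a, β) :: ps, x => by
    have ih := Pat_bounds N ps x
    have hl := altDepth_lit N a x β
    have hs := size_lit N a x β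
    simp only [Pat, altDepthAux, if_true, size, List.length_cons]
    constructor
    · have : max (altDepthAux 2 (Pat N ps x)) (altDepthAux 2 (lit N a x β)) ≤ 1 := max_le ih.1 hl.2
      omega
    · omega

/-- Auxiliary lemma `altDepth_Pat` (bounded-depth Frege toolkit / Pudlák–Krajíček construction, see the section header). [cite: Pudlak1991, §2 (Reduction Lemma 1)] -/
theorem altDepth_Pat (N : ℕ) (ps : List (ℕ × Bool)) (x : ℕ) : altDepth (Pat N ps x) ≤ 2 :=
  (altDepthAux_le_succ 0 2 _).trans (by have := (Pat_bounds N ps x).1; omega)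

/-- Size bound of node formulas of level `< s` over `N` vertices. [cite: Pudlak1991, §2 (Reduction Lemma 1)] -/
def sRn (N s : ℕ) : ℕ := s * (N * (3 * s + 3) + 3 * s + 4) + 1

/-- Auxiliary lemma `Mf_Pat_bounds` (bounded-depth Frege toolkit / Pudlák–Krajíček construction, see the section header). [cite: Pudlak1991, §2 (Reduction Lemma 1)] -/
theorem Mf_Pat_bounds (N : ℕ) (ps : List (ℕ × Bool)) (y x : ℕ) :
    altDepthAux 2 (Mf (Pat N ps) y x) ≤ 3 ∧ altDepth (Mf (Pat N ps) y x) ≤ 4 ∧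
      size (Mf (Pat N ps) y x) ≤ x * (3 * ps.length + 3) + 1 := by
  have hmem : ∀ A ∈ ((List.range x).filter fun u => y < u).map (fun u => neg (Pat N ps u)),
      altDepth A ≤ 3 ∧ size A ≤ 3 * ps.length + 2 := by
    intro A hA
    obtain ⟨u, _, _, rfl⟩ := mem_MfList.1 hA
    exact ⟨(altDepth_neg_le _).trans (by have := altDepth_Pat N ps u; omega),
      by simp [size]; exact (Pat_bounds N ps u).2⟩
  unfold Mf
  refine ⟨altDepthAux2_conjList_le fun A hA => (hmem A hA).1, altDepth_conjList_le fun A hA => (hmem A hA).1, ?_⟩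
  refine (size_conjList_le fun A hA => (hmem A hA).2).trans ?_
  have hl : (((List.range x).filter fun u => y < u).map (fun u => neg (Pat N ps u))).length ≤ x := by
    rw [List.length_map]; exact length_filter_range_le _ _
  have := Nat.mul_le_mul_right (3 * ps.length + 2 + 1) hl
  rw [show 3 * ps.length + 2 + 1 = 3 * ps.length + 3 from rfl] at this ⊢
  omega

/-- Auxiliary lemma `Rn_bounds` (bounded-depth Frege toolkit / Pudlák–Krajíček construction, see the section header). [cite: Pudlak1991, §2 (Reduction Lemma 1)] -/
theorem Rn_bounds (N : ℕ) : ∀ (x : ℕ) (ps : List (ℕ × Bool)), x < N → (∀ p ∈ ps, p.1 < N) →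
    altDepthAux 2 (Rn N x ps) ≤ 3 ∧
      size (Rn N x ps) ≤ ps.length * (N * (3 * ps.length + 3) + 3 * ps.length + 4) + 1
  | x, [], _, _ => by simp [Rn, size]
  | x, (y, β) :: ps, hx, hps => by
    have hy : y < N := hps (y, β) (by simp)
    have ih := Rn_bounds N y ps hy (fun p hp => hps p (by simp [hp]))
    have hP := Pat_bounds N ((y, β) :: ps) x
    have hM := Mf_Pat_bounds N ((y, β) :: ps) y x
    simp only [Rn, altDepthAux, if_true, size, List.length_cons] at ih hP hM ⊢
    constructor
    · have := ih.1; have := hP.1; have := hM.1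
      omega
    · have h1 := ih.2; have h2 := hP.2; have h3 := hM.2.2
      have h4 : x * (3 * (ps.length + 1) + 3) ≤ N * (3 * (ps.length + 1) + 3) := Nat.mul_le_mul_right _ hx.le
      have h5 : ps.length * (N * (3 * ps.length + 3) + 3 * ps.length + 4) ≤
          ps.length * (N * (3 * (ps.length + 1) + 3) + 3 * (ps.length + 1) + 4) :=
        Nat.mul_le_mul_left _ (by have := Nat.mul_le_mul_left N (show 3 * ps.length + 3 ≤ 3 * (ps.length + 1) + 3 from by omega); omega)
      have e : (ps.length + 1) * (N * (3 * (ps.length + 1) + 3) + 3 * (ps.length + 1) + 4) =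
          ps.length * (N * (3 * (ps.length + 1) + 3) + 3 * (ps.length + 1) + 4) +
            (N * (3 * (ps.length + 1) + 3) + 3 * (ps.length + 1) + 4) := by ring
      omega

/-- Auxiliary lemma `small_Rn` (bounded-depth Frege toolkit / Pudlák–Krajíček construction, see the section header). [cite: Pudlak1991, §2 (Reduction Lemma 1)] -/
theorem small_Rn {N s x : ℕ} {ps : List (ℕ × Bool)} (hx : x < N) (hv : ∀ p ∈ ps, p.1 < N)
    (hl : ps.length ≤ s) : Small 3 (sRn N s) (Rn N x ps) := by
  refine ⟨(Rn_bounds N x ps hx hv).1, (Rn_bounds N x ps hx hv).2.trans ?_⟩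
  unfold sRn
  have := Nat.mul_le_mul hl (show N * (3 * ps.length + 3) + 3 * ps.length + 4 ≤ N * (3 * s + 3) + 3 * s + 4 from by
    have := Nat.mul_le_mul_left N (show 3 * ps.length + 3 ≤ 3 * s + 3 from by omega); omega)
  omega

/-- Auxiliary lemma `altDepth_Rn` (bounded-depth Frege toolkit / Pudlák–Krajíček construction, see the section header). [cite: Pudlak1991, §2 (Reduction Lemma 1)] -/
theorem altDepth_Rn {N x : ℕ} {ps : List (ℕ × Bool)} (hx : x < N) (hv : ∀ p ∈ ps, p.1 < N) :
    altDepth (Rn N x ps) ≤ 4 :=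
  (altDepthAux_le_succ 0 2 _).trans (by have := (Rn_bounds N x ps hx hv).1; omega)

end PudlakDefs


/-! ### L14. Conjunctive paths and the disjointness of Pudlák's map (Claim 3) -/

/-- `CSub A B`: `A` is reached from `B` by descending through conjunctions. [cite: Pudlak1991, §2 (Reduction Lemma 1)] -/
inductive CSub : PropForm ℕ → PropForm ℕ → Prop
  /-- `refl` -/
  | refl (A : PropForm ℕ) : CSub A A
  /-- `left` -/
  | left {A B C : PropForm ℕ} : CSub A B → CSub A (conj B C)
  /-- `right` -/
  | right {A B C : PropForm ℕ} : CSub A C → CSub A (conj B C)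

/-- Auxiliary lemma `CSub.trans` (bounded-depth Frege toolkit / Pudlák–Krajíček construction, see the section header). [cite: Pudlak1991, §2 (Reduction Lemma 1)] -/
theorem CSub.trans {A B : PropForm ℕ} (h₁ : CSub A B) : ∀ {C : PropForm ℕ}, CSub B C → CSub A C
  | _, .refl _ => h₁
  | _, .left h => CSub.left (CSub.trans h₁ h)
  | _, .right h => CSub.right (CSub.trans h₁ h)

section NegPath

variable {Q : SPrm}

/-- `¬`-monotonicity along a conjunctive path. [cite: Pudlak1991, §2 (Reduction Lemma 1)] -/
theorem Sq.negPath' {A : PropForm ℕ} {L : List (PropForm ℕ)} {t : ℕ}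
    (hs : Sq Q t (neg A :: L)) (hW : L.length + 2 ≤ Q.W) :
    ∀ {B : PropForm ℕ}, CSub A B → Base Q (neg B) → Sq Q (t + 2 * size B) (neg B :: L)
  | _, .refl _, _ => hs.mono (by omega)
  | _, .left (C := C) h, hB =>
    (Sq.negConjOfLeft (B := C) (Sq.negPath' hs hW h hB.neg_of_negConj_left) hB hW).mono
      (by simp [size]; omega)
  | _, .right (B := B) h, hB =>
    (Sq.negConjOfRight (A := B) (Sq.negPath' hs hW h hB.neg_of_negConj_right) hB hW).mono
      (by simp [size]; omega)

/-- `¬`-monotonicity along a conjunctive path. [cite: Pudlak1991, §2 (Reduction Lemma 1)] -/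
theorem Sq.negPath {A B : PropForm ℕ} (h : CSub A B) {L : List (PropForm ℕ)} {t : ℕ}
    (hs : Sq Q t (neg A :: L)) (hB : Base Q (neg B)) (hW : L.length + 2 ≤ Q.W) :
    Sq Q (t + 2 * size B) (neg B :: L) :=
  Sq.negPath' hs hW h hB

end NegPath

/-- Auxiliary lemma `csub_lit_Pat` (bounded-depth Frege toolkit / Pudlák–Krajíček construction, see the section header). [cite: Pudlak1991, §2 (Reduction Lemma 1)] -/
theorem csub_lit_Pat (N x : ℕ) : ∀ (ps : List (ℕ × Bool)) {a : ℕ} {β : Bool},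
    (a, β) ∈ ps → CSub (lit N a x β) (Pat N ps x)
  | [], a, β, h => by simp at h
  | (y, c) :: ps, a, β, h => by
    simp only [List.mem_cons, Prod.mk.injEq] at h
    rcases h with ⟨rfl, rfl⟩ | h
    · exact CSub.right (CSub.refl _)
    · exact CSub.left (csub_lit_Pat N x ps h)

/-- Auxiliary lemma `csub_Rn_tail` (bounded-depth Frege toolkit / Pudlák–Krajíček construction, see the section header). [cite: Pudlak1991, §2 (Reduction Lemma 1)] -/
theorem csub_Rn_tail (N x y : ℕ) (β : Bool) (ps : List (ℕ × Bool)) :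
    CSub (Rn N y ps) (Rn N x ((y, β) :: ps)) :=
  CSub.left (CSub.left (CSub.refl _))

/-- Auxiliary lemma `csub_Pat_Rn` (bounded-depth Frege toolkit / Pudlák–Krajíček construction, see the section header). [cite: Pudlak1991, §2 (Reduction Lemma 1)] -/
theorem csub_Pat_Rn (N x y : ℕ) (β : Bool) (ps : List (ℕ × Bool)) :
    CSub (Pat N ((y, β) :: ps) x) (Rn N x ((y, β) :: ps)) :=
  CSub.left (CSub.right (CSub.refl _))

/-- Auxiliary lemma `csub_Mf_Rn` (bounded-depth Frege toolkit / Pudlák–Krajíček construction, see the section header). [cite: Pudlak1991, §2 (Reduction Lemma 1)] -/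
theorem csub_Mf_Rn (N x y : ℕ) (β : Bool) (ps : List (ℕ × Bool)) :
    CSub (Mf (Pat N ((y, β) :: ps)) y x) (Rn N x ((y, β) :: ps)) :=
  CSub.right (CSub.refl _)

/-- A lower node formula sits inside the formula of any extension. [cite: Pudlak1991, §2 (Reduction Lemma 1)] -/
theorem csub_Rn_suffix (N : ℕ) : ∀ (x : ℕ) (pre : List (ℕ × Bool)) (b : ℕ) (β : Bool) (qs : List (ℕ × Bool)),
    CSub (Rn N b qs) (Rn N x (pre ++ (b, β) :: qs))
  | x, [], b, β, qs => csub_Rn_tail N x b β qs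
  | x, (p, γ) :: pre, b, β, qs =>
    (csub_Rn_suffix N p pre b β qs).trans (by simpa using csub_Rn_tail N x p γ (pre ++ (b, β) :: qs))

/-- Size budget of the Pudlák formulas. [cite: Pudlak1991, §2 (Reduction Lemma 1)] -/
def mPud (N s : ℕ) : ℕ := 4 * sRn N s + lnpM N (3 * s + 1) + 16

/-- Parameter bundle of the Pudlák reduction. [cite: Pudlak1991, §2 (Reduction Lemma 1)] -/
structure PK (Q : SPrm) where
  /-- size of the homogeneous set -/
  k : ℕ
  /-- number of vertices `4^k` -/
  N : ℕ
  /-- `s = 2k`, `N = 2^s` -/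
  s : ℕ
  /-- master bound -/
  Y : ℕ
  /-- `hk` -/
  hk : 2 ≤ k
  /-- `hs` -/
  hs : s = 2 * k
  /-- `hN` -/
  hN : N = 2 ^ s
  /-- `hQD` -/
  hQD : 16 ≤ Q.D
  /-- `hM` -/
  hM : mPud N s ≤ Q.M
  /-- `hMC` -/
  hMC : size (ofCNF (ramseyCNF N k)) + 2 ≤ Q.M
  /-- `hW` -/
  hW : 8 * Y ≤ Q.W
  /-- `hY` -/
  hY : 16 ≤ Y
  /-- `hNY` -/
  hNY : (2 * N) ^ (s + 1) ≤ Y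
  /-- `hCY` -/
  hCY : (ramseyCNF N k).length ≤ Y
  /-- `hKY` -/
  hKY : N * (s * (2 * N) ^ s) ≤ Y

namespace PK

variable {Q : SPrm} (P : PK Q)

/-- The context: the Ramsey formula. [cite: Pudlak1991, §2 (Reduction Lemma 1)] -/
def Γ : List (PropForm ℕ) := [ramseyForm P.N P.k]

/-- Auxiliary lemma `four_le_s` (bounded-depth Frege toolkit / Pudlák–Krajíček construction, see the section header). [cite: Pudlak1991, §2 (Reduction Lemma 1)] -/
theorem four_le_s : 4 ≤ P.s := by have := P.hk; have := P.hs; omega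

/-- Auxiliary lemma `s_lt_N` (bounded-depth Frege toolkit / Pudlák–Krajíček construction, see the section header). [cite: Pudlak1991, §2 (Reduction Lemma 1)] -/
theorem s_lt_N : P.s < P.N := by rw [P.hN]; exact Nat.lt_two_pow_self

/-- Auxiliary lemma `sixteen_le_N` (bounded-depth Frege toolkit / Pudlák–Krajíček construction, see the section header). [cite: Pudlak1991, §2 (Reduction Lemma 1)] -/
theorem sixteen_le_N : 16 ≤ P.N := by
  rw [P.hN]
  calc 16 = 2 ^ 4 := rfl
    _ ≤ 2 ^ P.s := Nat.pow_le_pow_right (by norm_num) P.four_le_s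

/-- Auxiliary lemma `N_le_Y` (bounded-depth Frege toolkit / Pudlák–Krajíček construction, see the section header). [cite: Pudlak1991, §2 (Reduction Lemma 1)] -/
theorem N_le_Y : P.N ≤ P.Y := by
  have h1 : P.N ≤ 2 * P.N := by omega
  have h2 : 2 * P.N ≤ (2 * P.N) ^ (P.s + 1) := by
    calc 2 * P.N = (2 * P.N) ^ 1 := (pow_one _).symm
      _ ≤ (2 * P.N) ^ (P.s + 1) := Nat.pow_le_pow_right (by have := P.sixteen_le_N; omega) (by omega)
  exact h1.trans (h2.trans P.hNY)

/-- Auxiliary lemma `sRn_le` (bounded-depth Frege toolkit / Pudlák–Krajíček construction, see the section header). [cite: Pudlak1991, §2 (Reduction Lemma 1)] -/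
theorem sRn_le : sRn P.N P.s + 2 ≤ Q.M := by have := P.hM; unfold mPud at this; omega

/-- Auxiliary lemma `sRn_ge` (bounded-depth Frege toolkit / Pudlák–Krajíček construction, see the section header). [cite: Pudlak1991, §2 (Reduction Lemma 1)] -/
theorem sRn_ge : P.N * (3 * P.s + 3) + 3 * P.s + 4 ≤ sRn P.N P.s := by
  unfold sRn
  have := Nat.le_mul_of_pos_left (P.N * (3 * P.s + 3) + 3 * P.s + 4) (show 0 < P.s from by have := P.four_le_s; omega)
  omega

/-- Auxiliary lemma `base_Rn` (bounded-depth Frege toolkit / Pudlák–Krajíček construction, see the section header). [cite: Pudlak1991, §2 (Reduction Lemma 1)] -/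
theorem base_Rn {x : ℕ} {ps : List (ℕ × Bool)} (hx : x < P.N) (hv : ∀ p ∈ ps, p.1 < P.N) (hl : ps.length ≤ P.s) :
    Base Q (Rn P.N x ps) ∧ Base Q (neg (Rn P.N x ps)) ∧ Base Q (neg (neg (Rn P.N x ps))) :=
  (small_Rn hx hv hl).base (by have := P.hQD; omega) P.sRn_le

/-- Auxiliary lemma `base_Pat` (bounded-depth Frege toolkit / Pudlák–Krajíček construction, see the section header). [cite: Pudlak1991, §2 (Reduction Lemma 1)] -/
theorem base_Pat {ps : List (ℕ × Bool)} (hl : ps.length ≤ P.s) (x : ℕ) :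
    Base Q (Pat P.N ps x) ∧ Base Q (neg (Pat P.N ps x)) ∧ Base Q (neg (neg (Pat P.N ps x))) := by
  have hb := Pat_bounds P.N ps x
  have hd := altDepth_Pat P.N ps x
  have := P.sRn_le; have := P.sRn_ge; have := P.hQD
  have : 3 * ps.length + 1 ≤ 3 * P.s + 1 := by omega
  have h1 := altDepth_neg_le (Pat P.N ps x)
  have h2 := altDepth_neg_le (neg (Pat P.N ps x))
  exact ⟨⟨by omega, by omega⟩, ⟨by omega, by simp [size]; omega⟩, ⟨by omega, by simp [size]; omega⟩⟩

/-- Auxiliary lemma `base_Mf` (bounded-depth Frege toolkit / Pudlák–Krajíček construction, see the section header). [cite: Pudlak1991, §2 (Reduction Lemma 1)] -/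
theorem base_Mf {ps : List (ℕ × Bool)} (hl : ps.length ≤ P.s) {y x : ℕ} (hx : x ≤ P.N) :
    Base Q (Mf (Pat P.N ps) y x) ∧ Base Q (neg (Mf (Pat P.N ps) y x)) := by
  have hb := Mf_Pat_bounds P.N ps y x
  have := P.sRn_le; have := P.sRn_ge; have := P.hQD
  have h0 : x * (3 * ps.length + 3) ≤ P.N * (3 * P.s + 3) := Nat.mul_le_mul hx (by omega)
  have h1 := altDepth_neg_le (Mf (Pat P.N ps) y x)
  exact ⟨⟨by omega, by omega⟩, ⟨by omega, by simp [size]; omega⟩⟩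

/-- Auxiliary lemma `base_Qn` (bounded-depth Frege toolkit / Pudlák–Krajíček construction, see the section header). [cite: Pudlak1991, §2 (Reduction Lemma 1)] -/
theorem base_Qn {y : ℕ} {ps : List (ℕ × Bool)} (hy : y < P.N) (hv : ∀ p ∈ ps, p.1 < P.N)
    (hl : ps.length + 1 ≤ P.s) (β : Bool) (x : ℕ) :
    Base Q (Qn P.N y ps β x) ∧ Base Q (neg (Qn P.N y ps β x)) := by
  have hRs := (small_Rn (s := P.s) hy hv (by omega)).2
  have hP := Pat_bounds P.N ((y, β) :: ps) x
  have hdR := altDepth_Rn hy hv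
  have hdP := altDepth_Pat P.N ((y, β) :: ps) x
  have := P.hM; unfold mPud at this
  have := P.sRn_ge; have := P.hQD
  unfold Qn
  have hd := altDepth_conj_le (Rn P.N y ps) (Pat P.N ((y, β) :: ps) x)
  have : max (altDepth (Rn P.N y ps)) (altDepth (Pat P.N ((y, β) :: ps) x)) ≤ 4 := max_le hdR (by omega)
  have h1 := altDepth_neg_le (conj (Rn P.N y ps) (Pat P.N ((y, β) :: ps) x))
  simp only [List.length_cons] at hP
  refine ⟨⟨by omega, by simp [size]; omega⟩, ⟨by omega, by simp [size]; omega⟩⟩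

/-- Auxiliary lemma `ypow_mono` (bounded-depth Frege toolkit / Pudlák–Krajíček construction, see the section header). [cite: Pudlak1991, §2 (Reduction Lemma 1)] -/
theorem ypow_mono {i j : ℕ} (hij : i ≤ j) : P.Y ^ i ≤ P.Y ^ j :=
  Nat.pow_le_pow_right (by have := P.hY; omega) hij

/-- Auxiliary lemma `ydbl` (bounded-depth Frege toolkit / Pudlák–Krajíček construction, see the section header). [cite: Pudlak1991, §2 (Reduction Lemma 1)] -/
theorem ydbl (i : ℕ) : P.Y ^ i + P.Y ^ i ≤ P.Y ^ (i + 1) := by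
  have hY := P.hY
  rw [pow_succ]
  calc P.Y ^ i + P.Y ^ i = P.Y ^ i * 2 := by ring
    _ ≤ P.Y ^ i * P.Y := Nat.mul_le_mul_left _ (by omega)

/-- Auxiliary lemma `yge` (bounded-depth Frege toolkit / Pudlák–Krajíček construction, see the section header). [cite: Pudlak1991, §2 (Reduction Lemma 1)] -/
theorem yge (i : ℕ) (hi : 1 ≤ i) : P.Y ≤ P.Y ^ i := by
  calc P.Y = P.Y ^ 1 := (pow_one _).symm
    _ ≤ P.Y ^ i := P.ypow_mono hi

/-- Auxiliary lemma `sRn_le_Y` (bounded-depth Frege toolkit / Pudlák–Krajíček construction, see the section header). [cite: Pudlak1991, §2 (Reduction Lemma 1)] -/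
theorem sRn_le_Y : sRn P.N P.s ≤ P.Y := by
  unfold sRn
  have hs := P.s_lt_N
  have h16 := P.sixteen_le_N
  set B := P.N * (3 * P.s + 3) + 3 * P.s + 4 with hB
  have f1 : P.N * (3 * P.s + 3) ≤ P.N * (3 * P.N) := Nat.mul_le_mul_left _ (by omega)
  have f2 : 3 * P.s + 4 ≤ P.N * P.N := by nlinarith
  have f3 : P.N * (3 * P.N) = 3 * (P.N * P.N) := by ring
  have h1 : B ≤ 4 * (P.N * P.N) := by omega
  have h2 : P.s * B + 1 ≤ P.N * B := by
    have : (P.s + 1) * B ≤ P.N * B := Nat.mul_le_mul_right _ (by omega)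
    have : 1 ≤ B := by omega
    nlinarith
  have h3 : P.N * B ≤ P.N * (4 * (P.N * P.N)) := Nat.mul_le_mul_left _ h1
  have h4 : P.N * (4 * (P.N * P.N)) ≤ (2 * P.N) ^ (P.s + 1) := by
    calc P.N * (4 * (P.N * P.N)) ≤ P.N * (8 * (P.N * P.N)) := Nat.mul_le_mul_left _ (by omega)
      _ = (2 * P.N) ^ 3 := by ring
      _ ≤ (2 * P.N) ^ (P.s + 1) := Nat.pow_le_pow_right (by omega) (by have := P.four_le_s; omega)
  have := P.hNY
  omega

/-- Auxiliary lemma `Y16` (bounded-depth Frege toolkit / Pudlák–Krajíček construction, see the section header). [cite: Pudlak1991, §2 (Reduction Lemma 1)] -/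
theorem Y16 : 16 * P.Y ≤ P.Y ^ 2 := by have := P.hY; nlinarith

variable {Γ' : List (PropForm ℕ)} (hΓ' : ∀ A ∈ Γ', Base Q A) (hWΓ : Γ'.length + 4 ≤ Q.W)
include hΓ' hWΓ

/-- The base case of Claim 3: two distinct children of the same node. [cite: Pudlak1991, §2 (Reduction Lemma 1)] -/
theorem disj_children {j y x₁ x₂ : ℕ} {ps : List (ℕ × Bool)} {β : Bool} (hps : ps ∈ nodeLists j y)
    (hy1 : y < x₁) (h12 : x₁ < x₂) (hx2 : x₂ < P.N) (hj : j + 2 ≤ P.s) :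
    Sq Q (P.Y ^ 3) (neg (Rn P.N x₁ ((y, β) :: ps)) :: neg (Rn P.N x₂ ((y, β) :: ps)) :: Γ') := by
  obtain ⟨hlen, hv⟩ := nodeLists_spec hps
  have hY := P.hY
  have hvN : ∀ p ∈ (y, β) :: ps, p.1 < P.N := by
    intro p hp; simp only [List.mem_cons] at hp
    rcases hp with rfl | hp
    · simp; omega
    · have := hv p hp; omega
  set Pf := Pat P.N ((y, β) :: ps) x₁ with hPf
  have hbP := P.base_Pat (ps := (y, β) :: ps) (by simp; omega) x₁
  have hbR1 := P.base_Rn (x := x₁) (ps := (y, β) :: ps) (by omega) hvN (by simp; omega)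
  have hbR2 := P.base_Rn (x := x₂) (ps := (y, β) :: ps) hx2 hvN (by simp; omega)
  have hbM := P.base_Mf (ps := (y, β) :: ps) (by simp; omega) (y := y) (x := x₂) hx2.le
  have a0 : Sq Q 1 (neg Pf :: neg (neg Pf) :: Γ') :=
    Sq.ax (A := neg Pf) (by
      intro C hC; simp only [List.mem_cons] at hC
      rcases hC with rfl | rfl | hC
      · exact hbP.2.1
      · exact hbP.2.2
      · exact hΓ' C hC) (by simp; omega) (by simp) (by simp)
  have a1 := Sq.negPath (csub_Pat_Rn P.N x₁ y β ps) a0 hbR1.2.1 (by simp; omega)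
  have a2 := a1.swap
  have hmem : neg Pf ∈ ((List.range x₂).filter fun u => y < u).map (fun u => neg (Pat P.N ((y, β) :: ps) u)) :=
    mem_MfList.2 ⟨x₁, hy1, h12, rfl⟩
  have a3 := Sq.negAndOfMem (L := neg (Rn P.N x₁ ((y, β) :: ps)) :: Γ') (by simp; omega) _ hmem
    (by simpa [Mf] using hbM.2) a2
  have a4 := Sq.negPath (csub_Mf_Rn P.N x₂ y β ps) (by simpa [Mf] using a3) hbR2.2.1 (by simp; omega)
  refine a4.swap.mono ?_
  have s1 := (small_Rn (N := P.N) (s := P.s) (x := x₁) (ps := (y, β) :: ps) (by omega) hvN (by simp; omega)).2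
  have s2 := (small_Rn (N := P.N) (s := P.s) (x := x₂) (ps := (y, β) :: ps) hx2 hvN (by simp; omega)).2
  have hl : (((List.range x₂).filter fun u => y < u).map (fun u => neg (Pat P.N ((y, β) :: ps) u))).length ≤ P.N := by
    rw [List.length_map]; exact (length_filter_range_le _ _).trans hx2.le
  have hr : ((List.range x₂).filter fun u => y < u).length ≤ P.N := (length_filter_range_le _ _).trans hx2.le
  have := P.sRn_le_Y; have := P.N_le_Y; have := P.Y16
  have : P.Y ^ 2 ≤ P.Y ^ 3 := P.ypow_mono (by norm_num)
  omega

/-- **Claim 3** (Pudlák 1991): two distinct nodes with the same colours exclude each other. [cite: Pudlak1991, §2 (Reduction Lemma 1)] -/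
theorem disj_nodes : ∀ (j : ℕ) {x₁ x₂ : ℕ} {ps₁ ps₂ : List (ℕ × Bool)},
    ps₁ ∈ nodeLists j x₁ → ps₂ ∈ nodeLists j x₂ → (x₁, ps₁) ≠ (x₂, ps₂) →
    ps₁.map Prod.snd = ps₂.map Prod.snd → x₁ < P.N → x₂ < P.N → j + 1 ≤ P.s →
    Sq Q ((j + 1) * P.Y ^ 3) (neg (Rn P.N x₁ ps₁) :: neg (Rn P.N x₂ ps₂) :: Γ')
  | 0, x₁, x₂, ps₁, ps₂, h1, h2, hne, _, _, _, _ => by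
    obtain ⟨rfl, rfl⟩ := mem_nodeLists_zero.1 h1
    obtain ⟨rfl, rfl⟩ := mem_nodeLists_zero.1 h2
    exact absurd rfl hne
  | j + 1, x₁, x₂, ps₁, ps₂, h1, h2, hne, hcs, hx1, hx2, hj => by
    have hY := P.hY
    obtain ⟨y₁, hy1, ps₁', hps1, β₁, rfl⟩ := mem_nodeLists_succ.1 h1
    obtain ⟨y₂, hy2, ps₂', hps2, β₂, rfl⟩ := mem_nodeLists_succ.1 h2
    simp only [List.map_cons, List.cons.injEq] at hcs
    obtain ⟨hβ, hcs'⟩ := hcs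
    subst hβ
    have hv1 := (nodeLists_spec hps1).2
    have hv2 := (nodeLists_spec hps2).2
    have hl1 := (nodeLists_spec hps1).1
    have hl2 := (nodeLists_spec hps2).1
    have hp3 : 1 ≤ P.Y ^ 3 := Nat.one_le_pow _ _ (by omega)
    have e3 : (j + 1 + 1) * P.Y ^ 3 = (j + 1) * P.Y ^ 3 + P.Y ^ 3 := by ring
    by_cases hyy : (y₁, ps₁') = (y₂, ps₂')
    · simp only [Prod.mk.injEq] at hyy
      obtain ⟨rfl, rfl⟩ := hyy
      have hx : x₁ ≠ x₂ := fun h => hne (by rw [h])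
      rcases Nat.lt_or_gt_of_ne hx with hlt | hlt
      · exact (P.disj_children hΓ' hWΓ hps1 hy1 hlt hx2 (by omega)).mono (by nlinarith)
      · exact (P.disj_children hΓ' hWΓ hps1 hy2 hlt hx1 (by omega)).swap.mono (by nlinarith)
    · have ih := disj_nodes j hps1 hps2 hyy hcs' (by omega) (by omega) (by omega)
      have hvx1 : ∀ p ∈ (y₁, β₁) :: ps₁', p.1 < P.N := by
        intro p hp; simp only [List.mem_cons] at hp
        rcases hp with rfl | hp
        · simp; omega
        · have := hv1 p hp; omega
      have hvx2 : ∀ p ∈ (y₂, β₁) :: ps₂', p.1 < P.N := by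
        intro p hp; simp only [List.mem_cons] at hp
        rcases hp with rfl | hp
        · simp; omega
        · have := hv2 p hp; omega
      have hbR1 := P.base_Rn hx1 hvx1 (by simp; omega)
      have hbR2 := P.base_Rn hx2 hvx2 (by simp; omega)
      have b1 := Sq.negPath (csub_Rn_tail P.N x₁ y₁ β₁ ps₁') ih hbR1.2.1 (by simp; omega)
      have b2 := Sq.negPath (csub_Rn_tail P.N x₂ y₂ β₁ ps₂') b1.swap hbR2.2.1 (by simp; omega)
      refine b2.swap.mono ?_
      have s1 := (small_Rn (N := P.N) (s := P.s) hx1 hvx1 (by simp; omega)).2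
      have s2 := (small_Rn (N := P.N) (s := P.s) hx2 hvx2 (by simp; omega)).2
      have := P.sRn_le_Y; have := P.Y16
      have : P.Y ^ 2 ≤ P.Y ^ 3 := P.ypow_mono (by norm_num)
      omega

end PK


/-! ### L15. The Ramsey clauses as virtual hypotheses; nodes of level `s - 1` are impossible -/

section RamseyClauses

/-- The formula of a literal as in `PropForm.ofCNF`. [cite: Pudlak1991, §2 (Reduction Lemma 1)] -/
def litf (l : Literal ℕ) : PropForm ℕ := if l.2 then var l.1 else neg (var l.1)

/-- The formula of a clause as in `PropForm.ofCNF`. [cite: Pudlak1991, §2 (Reduction Lemma 1)] -/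
def clauseF (c : Clause ℕ) : PropForm ℕ := disjList (c.map litf)

/-- Auxiliary lemma `clauseF_eq` (bounded-depth Frege toolkit / Pudlák–Krajíček construction, see the section header). [cite: Pudlak1991, §2 (Reduction Lemma 1)] -/
theorem clauseF_eq (c : Clause ℕ) :
    c.foldr (fun l d => disj (if l.2 then var l.1 else neg (var l.1)) d) (const false) = clauseF c := by
  unfold clauseF disjList litf
  rw [List.foldr_map]

/-- Auxiliary lemma `ofCNF_eq` (bounded-depth Frege toolkit / Pudlák–Krajíček construction, see the section header). [cite: Pudlak1991, §2 (Reduction Lemma 1)] -/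
theorem ofCNF_eq (φ : CNF ℕ) : ofCNF φ = conjList (φ.map clauseF) := by
  unfold ofCNF conjList
  rw [List.foldr_map]
  congr 1
  funext c acc
  rw [clauseF_eq]

/-- Auxiliary lemma `size_litf` (bounded-depth Frege toolkit / Pudlák–Krajíček construction, see the section header). [cite: Pudlak1991, §2 (Reduction Lemma 1)] -/
theorem size_litf (l : Literal ℕ) : size (litf l) ≤ 2 := by
  unfold litf; split_ifs <;> simp [size]

/-- Auxiliary lemma `altDepth_litf` (bounded-depth Frege toolkit / Pudlák–Krajíček construction, see the section header). [cite: Pudlak1991, §2 (Reduction Lemma 1)] -/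
theorem altDepth_litf (l : Literal ℕ) : altDepth (litf l) ≤ 1 := by
  unfold litf; split_ifs <;> simp [altDepth, altDepthAux]

/-- Auxiliary lemma `clauseF_bounds` (bounded-depth Frege toolkit / Pudlák–Krajíček construction, see the section header). [cite: Pudlak1991, §2 (Reduction Lemma 1)] -/
theorem clauseF_bounds (c : Clause ℕ) : altDepth (clauseF c) ≤ 2 ∧ size (clauseF c) ≤ c.length * 3 + 1 := by
  unfold clauseF
  refine ⟨altDepth_disjList_le fun A hA => ?_, (size_disjList_le (b := 2) fun A hA => ?_).trans (by simp)⟩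
  · obtain ⟨l, _, rfl⟩ := List.mem_map.1 hA; exact altDepth_litf l
  · obtain ⟨l, _, rfl⟩ := List.mem_map.1 hA; exact size_litf l

/-- Auxiliary lemma `altDepth_ofCNF` (bounded-depth Frege toolkit / Pudlák–Krajíček construction, see the section header). [cite: Pudlak1991, §2 (Reduction Lemma 1)] -/
theorem altDepth_ofCNF (φ : CNF ℕ) : altDepth (ofCNF φ) ≤ 3 := by
  rw [ofCNF_eq]
  refine altDepth_conjList_le fun A hA => ?_
  obtain ⟨c, _, rfl⟩ := List.mem_map.1 hA
  exact (clauseF_bounds c).1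

/-- The two Ramsey clauses of a `k`-set `S`. [cite: Pudlak1991, §2 (Reduction Lemma 1)] -/
def clNeg (N : ℕ) (S : List ℕ) : Clause ℕ :=
  ((S ×ˢ S).filter fun p => p.1 < p.2).map fun p => (p.1 * N + p.2, false)

/-- The two Ramsey clauses of a `k`-set `S`. [cite: Pudlak1991, §2 (Reduction Lemma 1)] -/
def clPos (N : ℕ) (S : List ℕ) : Clause ℕ :=
  ((S ×ˢ S).filter fun p => p.1 < p.2).map fun p => (p.1 * N + p.2, true)

/-- Auxiliary lemma `ramseyCNF_eq` (bounded-depth Frege toolkit / Pudlák–Krajíček construction, see the section header). [cite: Pudlak1991, §2 (Reduction Lemma 1)] -/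
theorem ramseyCNF_eq (N k : ℕ) :
    ramseyCNF N k = ((List.range N).sublistsLen k).flatMap fun S => [clNeg N S, clPos N S] := rfl

/-- Auxiliary lemma `mem_ramseyCNF` (bounded-depth Frege toolkit / Pudlák–Krajíček construction, see the section header). [cite: Pudlak1991, §2 (Reduction Lemma 1)] -/
theorem mem_ramseyCNF {N k : ℕ} {S : List ℕ} (hS : S ∈ (List.range N).sublistsLen k) :
    clNeg N S ∈ ramseyCNF N k ∧ clPos N S ∈ ramseyCNF N k := by
  rw [ramseyCNF_eq]
  simp only [List.mem_flatMap, List.mem_cons, List.mem_nil_iff, or_false]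
  exact ⟨⟨S, hS, Or.inl rfl⟩, ⟨S, hS, Or.inr rfl⟩⟩

/-- Auxiliary lemma `length_of_mem_ramseyCNF` (bounded-depth Frege toolkit / Pudlák–Krajíček construction, see the section header). [cite: Pudlak1991, §2 (Reduction Lemma 1)] -/
theorem length_of_mem_ramseyCNF {N k : ℕ} {c : Clause ℕ} (hc : c ∈ ramseyCNF N k) : c.length ≤ k * k := by
  rw [ramseyCNF_eq] at hc
  simp only [List.mem_flatMap, List.mem_cons, List.mem_nil_iff, or_false, List.mem_sublistsLen] at hc
  obtain ⟨S, ⟨_, hl⟩, rfl | rfl⟩ := hc <;>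
  · simp only [clNeg, clPos, List.length_map]
    refine (List.length_filter_le _ _).trans ?_
    rw [List.length_product, hl]

/-- Auxiliary lemma `length_ramseyCNF_le` (bounded-depth Frege toolkit / Pudlák–Krajíček construction, see the section header). [cite: Pudlak1991, §2 (Reduction Lemma 1)] -/
theorem length_ramseyCNF_le (N k : ℕ) : (ramseyCNF N k).length ≤ 2 * N ^ k := by
  rw [ramseyCNF_eq]
  refine (length_flatMap_le _ _ 2 fun S _ => by simp).trans ?_
  rw [List.length_sublistsLen, List.length_range, Nat.mul_comm]
  exact Nat.mul_le_mul_left _ (Nat.choose_le_pow N k)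

/-- Auxiliary lemma `mem_clNeg` (bounded-depth Frege toolkit / Pudlák–Krajíček construction, see the section header). [cite: Pudlak1991, §2 (Reduction Lemma 1)] -/
theorem mem_clNeg {N : ℕ} {S : List ℕ} {l : Literal ℕ} :
    l ∈ clNeg N S ↔ ∃ a ∈ S, ∃ b ∈ S, a < b ∧ l = (a * N + b, false) := by
  simp only [clNeg, List.mem_map, List.mem_filter, decide_eq_true_eq, Prod.exists, List.mem_product]
  constructor
  · rintro ⟨a, b, ⟨⟨ha, hb⟩, hab⟩, rfl⟩; exact ⟨a, ha, b, hb, hab, rfl⟩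
  · rintro ⟨a, ha, b, hb, hab, rfl⟩; exact ⟨a, b, ⟨⟨ha, hb⟩, hab⟩, rfl⟩

/-- Auxiliary lemma `mem_clPos` (bounded-depth Frege toolkit / Pudlák–Krajíček construction, see the section header). [cite: Pudlak1991, §2 (Reduction Lemma 1)] -/
theorem mem_clPos {N : ℕ} {S : List ℕ} {l : Literal ℕ} :
    l ∈ clPos N S ↔ ∃ a ∈ S, ∃ b ∈ S, a < b ∧ l = (a * N + b, true) := by
  simp only [clPos, List.mem_map, List.mem_filter, decide_eq_true_eq, Prod.exists, List.mem_product]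
  constructor
  · rintro ⟨a, b, ⟨⟨ha, hb⟩, hab⟩, rfl⟩; exact ⟨a, ha, b, hb, hab, rfl⟩
  · rintro ⟨a, ha, b, hb, hab, rfl⟩; exact ⟨a, b, ⟨⟨ha, hb⟩, hab⟩, rfl⟩

/-- A strictly increasing list of numbers below `n` is a sublist of `range n`. [cite: Pudlak1991, §2 (Reduction Lemma 1)] -/
theorem sublist_range'_of_pairwise : ∀ (l : List ℕ) (m n : ℕ), l.Pairwise (· < ·) →
    (∀ x ∈ l, m ≤ x) → (∀ x ∈ l, x < n) → l.Sublist (List.range' m (n - m))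
  | [], m, n, _, _, _ => List.nil_sublist _
  | a :: l, m, n, hp, hm, hn => by
    rw [List.pairwise_cons] at hp
    have ha1 : m ≤ a := hm a (by simp)
    have ha2 : a < n := hn a (by simp)
    have ih := sublist_range'_of_pairwise l (a + 1) n hp.2 (fun x hx => hp.1 x hx)
      (fun x hx => hn x (by simp [hx]))
    have e : List.range' m (n - m) = List.range' m (a - m) ++ (a :: List.range' (a + 1) (n - (a + 1))) := by
      have h1 : n - m = (a - m) + ((n - (a + 1)) + 1) := by omega
      have h2 : m + 1 * (a - m) = a := by omega
      rw [h1, ← List.range'_append (s := m) (m := a - m) (n := (n - (a + 1)) + 1) (step := 1), h2,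
        List.range'_succ]
    rw [e]
    exact (ih.cons_cons a).trans (List.sublist_append_right _ _)

/-- Auxiliary lemma `sublist_range_of_pairwise` (bounded-depth Frege toolkit / Pudlák–Krajíček construction, see the section header). [cite: Pudlak1991, §2 (Reduction Lemma 1)] -/
theorem sublist_range_of_pairwise {l : List ℕ} {n : ℕ} (hp : l.Pairwise (· < ·)) (hn : ∀ x ∈ l, x < n) :
    l.Sublist (List.range n) := by
  rw [List.range_eq_range']
  simpa using sublist_range'_of_pairwise l 0 n hp (fun x _ => Nat.zero_le x) hn

end RamseyClauses

namespace PK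

variable {Q : SPrm} (P : PK Q)

/-- Auxiliary lemma `k_lt_N` (bounded-depth Frege toolkit / Pudlák–Krajíček construction, see the section header). [cite: Pudlak1991, §2 (Reduction Lemma 1)] -/
theorem k_lt_N : P.k < P.N := by
  rw [P.hN, P.hs]
  calc P.k < 2 ^ P.k := Nat.lt_two_pow_self
    _ ≤ 2 ^ (2 * P.k) := Nat.pow_le_pow_right (by norm_num) (by omega)

/-- Auxiliary lemma `kk_le_N` (bounded-depth Frege toolkit / Pudlák–Krajíček construction, see the section header). [cite: Pudlak1991, §2 (Reduction Lemma 1)] -/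
theorem kk_le_N : P.k * P.k ≤ P.N := by
  rw [P.hN, P.hs, pow_mul, show (2:ℕ) ^ 2 = 4 from rfl]
  have h := (Nat.lt_two_pow_self (n := P.k)).le
  calc P.k * P.k ≤ 2 ^ P.k * 2 ^ P.k := Nat.mul_le_mul h h
    _ = (2 * 2) ^ P.k := (mul_pow 2 2 _).symm
    _ = 4 ^ P.k := by norm_num

/-- Auxiliary lemma `Γ_eq` (bounded-depth Frege toolkit / Pudlák–Krajíček construction, see the section header). [cite: Pudlak1991, §2 (Reduction Lemma 1)] -/
theorem Γ_eq : P.Γ = [neg (conjList ((ramseyCNF P.N P.k).map clauseF))] := by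
  simp [Γ, ramseyForm, ofCNF_eq]

/-- Auxiliary lemma `base_Γ` (bounded-depth Frege toolkit / Pudlák–Krajíček construction, see the section header). [cite: Pudlak1991, §2 (Reduction Lemma 1)] -/
theorem base_Γ : ∀ A ∈ P.Γ, Base Q A := by
  intro A hA
  simp only [Γ, List.mem_singleton] at hA
  subst hA
  refine ⟨?_, ?_⟩
  · exact (altDepth_neg_le _).trans (by have := altDepth_ofCNF (ramseyCNF P.N P.k); have := P.hQD; omega)
  · have := P.hMC; simp [ramseyForm, size]; omega

/-- Auxiliary lemma `base_clause` (bounded-depth Frege toolkit / Pudlák–Krajíček construction, see the section header). [cite: Pudlak1991, §2 (Reduction Lemma 1)] -/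
theorem base_clause {c : Clause ℕ} (hc : c ∈ ramseyCNF P.N P.k) :
    Base Q (clauseF c) ∧ Base Q (neg (clauseF c)) ∧
      ∀ l ∈ c, Base Q (litf l) ∧ Base Q (neg (litf l)) ∧ Base Q (neg (neg (litf l))) := by
  have hl := length_of_mem_ramseyCNF hc
  have hb := clauseF_bounds c
  have := P.kk_le_N; have := P.sRn_le; have := P.sRn_ge; have := P.hQD; have := P.four_le_s
  have hN3 : c.length * 3 + 1 + 1 ≤ sRn P.N P.s := by nlinarith
  refine ⟨⟨by omega, by omega⟩, ⟨(altDepth_neg_le _).trans (by omega), by simp [size]; omega⟩, ?_⟩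
  intro l _
  have h1 := altDepth_litf l; have h2 := size_litf l
  have h3 := altDepth_neg_le (litf l); have h4 := altDepth_neg_le (neg (litf l))
  exact ⟨⟨by omega, by omega⟩, ⟨by omega, by simp [size]; omega⟩, ⟨by omega, by simp [size]; omega⟩⟩

/-- The clauses of the Ramsey formula are available as hypotheses. [cite: Pudlak1991, §2 (Reduction Lemma 1)] -/
theorem virtClause {c : Clause ℕ} (hc : c ∈ ramseyCNF P.N P.k) : Sq Q (P.Y ^ 2) (P.Γ ++ c.map litf) := by
  have hY := P.hY
  have hW := P.hW
  have hl := length_of_mem_ramseyCNF hc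
  have hkk := P.kk_le_N
  have hNY := P.N_le_Y
  obtain ⟨bC, bnC, bL⟩ := P.base_clause hc
  set A := clauseF c with hA
  set Φ := (ramseyCNF P.N P.k).map clauseF with hΦ
  have hmem : A ∈ Φ := List.mem_map.2 ⟨c, hc, rfl⟩
  have hΦl : Φ.length ≤ P.Y := by rw [hΦ, List.length_map]; exact P.hCY
  have a0 : Sq Q 1 (neg A :: [A]) :=
    Sq.ax (A := A) (by
      intro C hC; simp only [List.mem_cons, List.mem_nil_iff, or_false] at hC
      rcases hC with rfl | rfl
      · exact bnC
      · exact bC) (by simp; omega) (by simp) (by simp)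
  have hbG : Base Q (neg (conjList Φ)) := by
    have := P.base_Γ; rw [P.Γ_eq] at this; exact this _ (by simp [hΦ])
  have a1 := Sq.negAndOfMem (L := [A]) (by simp; omega) Φ hmem hbG a0
  have a2 := a1.swap
  have e1 : (A :: neg (conjList Φ) :: []) = (disjList (c.map litf) :: P.Γ) := by
    rw [P.Γ_eq, hA, hΦ]; rfl
  rw [e1] at a2
  have a3 := Sq.unDisjList (c.map litf) a2 (by simp [Γ]; omega)
  have a4 := a3.weaken₂ (P.Γ ++ c.map litf)
    (by intro C hC; simp only [List.mem_append] at hC ⊢; tauto)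
    (by intro C hC; simp only [List.mem_append] at hC ⊢; tauto) (by simp [Γ]; omega)
  refine a4.mono ?_
  simp only [List.length_map]
  have := P.Y16
  nlinarith

/-- The literals of a Ramsey clause: complementary pairs. [cite: Pudlak1991, §2 (Reduction Lemma 1)] -/
theorem neg_litf_of_node {x : ℕ} {ps : List (ℕ × Bool)} {a b : ℕ} {β : Bool}
    (hpw : (x :: ps.map Prod.fst).Pairwise (· > ·)) (ha : (a, β) ∈ ps) (hb : (b, β) ∈ ps) (hab : a < b) :
    CSub (lit P.N a b β) (Rn P.N x ps) := by
  obtain ⟨pre, qs, hps⟩ := List.append_of_mem hb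
  subst hps
  rw [List.map_append, List.map_cons, List.pairwise_cons, List.pairwise_append] at hpw
  obtain ⟨_, _, hq, hpq⟩ := hpw
  have haq : (a, β) ∈ qs := by
    rw [List.mem_append, List.mem_cons] at ha
    rcases ha with ha | ha | ha
    · have := hpq a (List.mem_map.2 ⟨_, ha, rfl⟩) b (by simp)
      omega
    · simp only [Prod.mk.injEq] at ha; omega
    · exact ha
  have h1 : CSub (lit P.N a b β) (Pat P.N qs b) := csub_lit_Pat P.N b qs haq
  have h2 : CSub (Pat P.N qs b) (Rn P.N b qs) := by
    match qs, haq with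
    | (c, δ) :: qs', _ => exact csub_Pat_Rn P.N b c δ qs'
  exact (h1.trans h2).trans (csub_Rn_suffix P.N x pre b β qs)

/-- **No node of level `s - 1`**: such a node contains a homogeneous `k`-set, contradicting a
Ramsey clause (Pudlák 1991, proof of Thm. 1 from the Reduction Lemma). [cite: Pudlak1991, §2 (Reduction Lemma 1)] -/
theorem refute_top {x : ℕ} {ps : List (ℕ × Bool)} (hps : ps ∈ nodeLists (P.s - 1) x) (hx : x < P.N) :
    Sq Q (P.Y ^ 3) (neg (Rn P.N x ps) :: P.Γ) := by
  have hY := P.hY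
  have hW := P.hW
  have hkk := P.kk_le_N
  have hNY := P.N_le_Y
  obtain ⟨hlen, hv⟩ := nodeLists_spec hps
  have hpw := nodeLists_pairwise hps
  have hsk : P.s - 1 = 2 * P.k - 1 := by rw [P.hs]
  have hk := P.hk
  -- a colour class with at least `k` vertices
  have hcnt : ps.length = (ps.filter fun p => p.2).length + (ps.filter fun p => !p.2).length := by
    simpa using List.length_eq_length_filter_add (l := ps) (fun p => p.2)
  obtain ⟨β, F, hF, hFβ, hFk⟩ : ∃ (β : Bool) (F : List (ℕ × Bool)), F.Sublist ps ∧ (∀ p ∈ F, p.2 = β) ∧ P.k ≤ F.length := by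
    by_cases h : P.k ≤ (ps.filter fun p => p.2).length
    · exact ⟨true, ps.filter (fun p => p.2), List.filter_sublist,
        fun p hp => by simpa using (List.mem_filter.1 hp).2, h⟩
    · refine ⟨false, ps.filter (fun p => !p.2), List.filter_sublist,
        fun p hp => by simpa using (List.mem_filter.1 hp).2, ?_⟩
      omega
  set T := (F.map Prod.fst).take P.k with hT
  set S := T.reverse with hS
  have hTl : T.length = P.k := by rw [hT, List.length_take, List.length_map]; omega
  have hTsub : T.Sublist (ps.map Prod.fst) := (List.take_sublist _ _).trans (hF.map Prod.fst)
  have hTpw : T.Pairwise (· > ·) := (List.pairwise_cons.1 hpw).2.sublist hTsub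
  have hmemT : ∀ a ∈ T, (a, β) ∈ ps := by
    intro a ha
    have ha' : a ∈ F.map Prod.fst := (List.take_sublist _ _).subset ha
    obtain ⟨p, hp, rfl⟩ := List.mem_map.1 ha'
    have := hFβ p hp
    have hp' : p ∈ ps := hF.subset hp
    rcases p with ⟨a, b⟩
    simp at this; subst this; exact hp'
  have hSmem : ∀ a ∈ S, (a, β) ∈ ps := fun a ha => hmemT a (List.mem_reverse.1 ha)
  have hSN : ∀ a ∈ S, a < P.N := fun a ha => (hv _ (hSmem a ha)).trans hx
  have hSpw : S.Pairwise (· < ·) := by rw [hS, List.pairwise_reverse]; exact hTpw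
  have hSsub : S ∈ (List.range P.N).sublistsLen P.k :=
    List.mem_sublistsLen.2 ⟨sublist_range_of_pairwise hSpw hSN, by rw [hS, List.length_reverse, hTl]⟩
  obtain ⟨hcN, hcP⟩ := mem_ramseyCNF hSsub
  -- the clause and its literals
  set c := (if β then clNeg P.N S else clPos P.N S) with hc
  have hcmem : c ∈ ramseyCNF P.N P.k := by rw [hc]; split_ifs; exacts [hcN, hcP]
  have hcl : c.length ≤ P.k * P.k := length_of_mem_ramseyCNF hcmem
  have hlits : ∀ l ∈ c, ∃ a b, (a, β) ∈ ps ∧ (b, β) ∈ ps ∧ a < b ∧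
      ((β = true ∧ litf l = neg (lit P.N a b β)) ∨ (β = false ∧ lit P.N a b β = neg (litf l))) := by
    intro l hl
    rw [hc] at hl
    cases β
    · simp only [Bool.false_eq_true, if_false] at hl
      obtain ⟨a, ha, b, hb, hab, rfl⟩ := mem_clPos.1 hl
      exact ⟨a, b, hSmem a ha, hSmem b hb, hab, Or.inr ⟨rfl, by simp [lit, litf, ev]⟩⟩
    · simp only [if_true] at hl
      obtain ⟨a, ha, b, hb, hab, rfl⟩ := mem_clNeg.1 hl
      exact ⟨a, b, hSmem a ha, hSmem b hb, hab, Or.inl ⟨rfl, by simp [lit, litf, ev]⟩⟩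
  have hbR := P.base_Rn hx (fun p hp => (hv p hp).trans hx) (by omega) (ps := ps)
  have bL := (P.base_clause hcmem).2.2
  have s0 := (P.virtClause hcmem).weaken₂ (c.map litf ++ (neg (Rn P.N x ps) :: P.Γ))
    (by intro C hC; simp only [List.mem_append, List.mem_cons] at hC ⊢; tauto)
    (by
      intro C hC; simp only [List.mem_append, List.mem_cons] at hC ⊢
      rcases hC with hC | rfl | hC
      · exact Or.inl (Or.inr hC)
      · exact Or.inr hbR.2.1
      · exact Or.inl (Or.inl hC))
    (by simp [Γ]; omega)
  have s1 := Sq.multiCut (c.map litf) s0 (t' := 2 * sRn P.N P.s + 4) (by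
    intro L hL
    obtain ⟨l, hl, rfl⟩ := List.mem_map.1 hL
    obtain ⟨a, b, ha, hb, hab, hcase⟩ := hlits l hl
    have hcs := P.neg_litf_of_node hpw ha hb hab
    obtain ⟨b1, b2, b3⟩ := bL l hl
    have hΓb := P.base_Γ
    rcases hcase with ⟨rfl, h1⟩ | ⟨rfl, h1⟩
    · -- litf l = ¬ v, v ⊑ R
      have a0 : Sq Q 1 (neg (lit P.N a b true) :: neg (neg (lit P.N a b true)) :: P.Γ) :=
        Sq.ax (A := neg (lit P.N a b true)) (by
          intro C hC; simp only [List.mem_cons] at hC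
          rcases hC with rfl | rfl | hC
          · rw [← h1]; exact b1
          · rw [← h1]; exact b2
          · exact hΓb C hC) (by simp [Γ]; omega) (by simp) (by simp)
      have a1 := Sq.negPath hcs a0 hbR.2.1 (by simp [Γ]; omega)
      rw [← h1] at a1
      refine a1.swap.mono ?_
      have := (small_Rn (s := P.s) hx (fun p hp => (hv p hp).trans hx) (by omega) (ps := ps)).2
      omega
    · -- litf l = v, ¬ v ⊑ R
      have a0 : Sq Q 1 (neg (neg (litf l)) :: neg (litf l) :: P.Γ) :=
        Sq.ax (A := neg (litf l)) (by
          intro C hC; simp only [List.mem_cons] at hC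
          rcases hC with rfl | rfl | hC
          · exact b3
          · exact b2
          · exact hΓb C hC) (by simp [Γ]; omega) (by simp) (by simp)
      rw [← h1] at a0
      have a1 := Sq.negPath hcs a0 hbR.2.1 (by simp [Γ]; omega)
      rw [← h1]
      refine a1.swap.mono ?_
      have := (small_Rn (s := P.s) hx (fun p hp => (hv p hp).trans hx) (by omega) (ps := ps)).2
      omega)
  refine s1.mono ?_
  rw [List.length_map]
  have := P.sRn_le_Y
  have h1 : c.length * (2 * sRn P.N P.s + 4 + 2) ≤ P.Y * (2 * P.Y + 6) := Nat.mul_le_mul (by omega) (by omega)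
  have h2 : P.Y ^ 2 + 1 + P.Y * (2 * P.Y + 6) ≤ P.Y ^ 3 := by nlinarith
  omega

end PK


end DepthFrege

end Literature.Computability.MetaComplexity
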